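import Summits.AtomisticToContinuum.HydrodynamicLimit.Theses.InformationPercolationEngine
import Summits.AtomisticToContinuum.HydrodynamicLimit.Theorems.InformationPercolationEngineSpectralContractionR
import Literature.MathematicalPhysics.KineticTheory.VelocityBlindPlacement

/-!
# Disproof work file — crux `PercolationClosesChaos` (stmt-AtomisticToContinuum-15178, rev 12; records of stmt-13914 (rev 3) and stmt-14915 (rev 4) preserved)

Standing adversary: cycle 1 (seat `refuter-cdisprove-stmt-AtomisticToContinuum-13914-0`, 2026-08-15/16, F1–F4,
§1–§5b), cycle 2 (seat `…-13914-g2-0`, 2026-08-16, F5–F8, §6–§7), cycle 3 (seat `…-13914-g3-0`, 2026-08-16, F9–F11,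
§6c, §8–§9) and cycle 4 (seat `refuter-cdisprove-stmt-AtomisticToContinuum-14915-0`, 2026-08-16, F12–F15, §1–§2 re-cut,
§10–§11: the rev-4 re-filing and the line `Sketch`) and cycle 5 (seat `refuter-cdisprove-stmt-AtomisticToContinuum-15178-0`,
2026-08-16, F16–F19, §1/§1b re-cut for rev 12, §12: the rev-12 re-filing over `KickFairRelEquilibriumMeso`, crux 3 PROVED, and
the NEW line `Sketch` = card ergodic-window-is-von-neumann). Crux (rev 12 of route InformationPercolationEngine, route-choice
2026-08-16 12:31Z; rev 3 read `KickIsotropyInfo → …` (stmt-13914), rev 4 `KickFairRelEquilibrium → …` (stmt-14915), now history):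

  `PercolationClosesChaos : KickFairRelEquilibriumMeso → SpectralContractionR → ContactChaos`.
## Findings (numbers, not adjectives)

* **F1 — what a kill costs (§1).** `¬ PercolationClosesChaos ↔ Kick ∧ SpectralContractionR ∧ ¬ ContactChaos`
  (`not_crux_iff`; Kick = `KickIsotropyInfo` at rev 3, `KickFairRelEquilibrium` at rev 4, F12). A Lean refutation
  therefore needs PROOFS of cruxes 2 and 3 and a REFUTATION of the route target
  (summit-level negative evidence). Conversely the crux follows from `ContactChaos` alone and, ex falso, from
  `¬ Kick` or `¬ SpectralContractionR` (`crux_of_*`). No junk in the three bodies makes any of these cheap: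
  conventions of `hardSphereKernel (w, v) ω` = `((w - v)·ω)₊` match the incoming hemisphere of
  `impactVec`/`preVel` (also checked by rreview-0815T19-6-0); `localGibbsLaw` is a probability measure for small σ;
  `HardSphereFlow` admits no junk flows (orbits of the conull good set are genuine trajectories, laws are a.c.).

* **F2 — the crux is (very likely) VACUOUSLY TRUE as filed (§2; rev 3 — for rev 4 see F13).** Its first hypothesis `KickIsotropyInfo`
  (stmt-13478) is false already under the INVARIANT Gibbs law at every fixed σ > 0: the typed coarse past (r-cells +
  EXACT velocities of ALL spheres at the two flight starts) exposes the partner's previous contact direction, and static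
  three-body exclusion empties the cap `{ω · ω_l > 1/2}` of impact vectors while that previous partner is adjacent
  (stratum weight ≍ ε/mfp = √2·π·σ³, N-independent) — refuter-rattack-13478 (EVIDENCE.md 19:54Z, bias integral
  +0.080 ± 0.001), confirmed independently by three planner seats (SHIELDING.md 22:26Z with `three_sphere_cap` PROVED,
  ANALYSIS.md, ANALYSIS-v2.md, REPAIR.md) and reduced sorry-free to `ShieldingBiasPersists → ¬ KickIsotropyInfo`
  (cdisprove-13478, KickIsotropyInfoShieldingReduction.lean); MD corroborations kit j004262/j004861/j005912/j006161.
  This seat adds an independent second witness class (ring-lens, NOTES.md §R): on the certified 3-ring stratum the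
  impact parameter is confined to a lens `D ∩ (D + s)` with posterior weight O(1) (odds = p₁/(π n ε² ℓ) = √2·p₁ = O(1)
  because `π n ε² ℓ = 1/√2` — the coarse cell volume cancels), so the conditional kick law is not flux-uniform there either. Consequence HERE
  (`crux_of_not_kickIsotropyInfo`): once ¬KickIsotropyInfo is landed (it needs a constructed torus flow + Palm calculus,
  not in tree), this dock closes `proved` for the wrong reason; it must be RE-FILED together with the repaired kick
  statement (planner: SHIELDING.md §4 "restate 13478+13480 together"). Nothing for a disprover to kill.

* **F3 — the spectral hypothesis is MIS-DOCKED: the engine consumes λ₂(K) < 1/2, the crux supplies λ₂(K)² < 1/2 (§3).**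
  Exact kinematics of one hard-sphere collision in the flux pair law Λ ∝ |v−w| M(v) M(w): with P = v + w, r = |v − w|,
  the outgoing velocity is `V' = P/2 + (r/2) n` with `n` UNIFORM on S² and independent of (P, r, (v−w)/r) (flux-distributed
  ω ⇒ cos²θ uniform ⇒ Archimedes; = card local-kac-gap-shadow's `OneCollisionRandomisesDirection`), while the incoming
  `V = P/2 + (r/2) u` has `u` uniform and independent as well. Hence `(V, V')` and `(V', V'')` (two outputs of the SAME
  parents with independent impact vectors) are equal in law, so the one-collision operator `K` of `SpectralContractionR`
  EQUALS the two-output operator of the two-parent channel `(v, w) ↦ v'`, and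
      ⟨K f, f⟩_π = E[(E[f(V') | V, W])²]  for every f ∈ L²(π)               (K is PSD — the route's own remark)
  i.e. the input-restricted JOINT-parent χ²-contraction coefficient of a collision vertex is
      η_χ²((V,W) → V'; Λ) = λ₂(K) = 0.4682 (NOT λ₂(K)² = 0.219).
  Certified: exact rational Rayleigh–Ritz lower bounds (this seat, kit j007068; pure-rational moments of
  a = |P|²/4 ~ Γ(3/2), b = r²/4 ~ Γ(2), t ~ U[−1,1]) reproduce the route's sector values EXACTLY — 3/7 (linear),
  7/15 (energy), 15/79 (harmonic quadratic) — and give λ₂(K) ≥ 14940771876691/31910798839515 = 0.468204… (ℓ = 0,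
  radial degree 4, exact rational arithmetic); the ℓ = 0 Ritz sequence is 7/15 = 0.46667 (deg 1), 0.468029, 0.468178,
  0.468204, 0.468211, 0.468212 (deg 6): λ₂(K) = 0.46821(1); ℓ = 1 top 0.432938 (3/7 = 0.42857 at deg 0), ℓ = 2 top
  0.204478 (15/79 at deg 0). The route's "λ₂ = 0.468 ± 0.001 (33-dim Galerkin 0.4678)" is this ℓ = 0 mode. CONSEQUENCES for steps (iii)–(iv) of the intended proof:
  (a) Polyanskiy–Wu 2017 Thm 5 (arXiv:1508.06025 §3, p. 7 — read: η_v := η_KL(P_{Y_v|Y_pa(v)}), INPUT-FREE, proof via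
      the KL chain rule I(U;V,W) = I(U;V) + I(U;W|V)) is void verbatim (input-free η of the collision vertex = 1: disjoint
      output spheres; cdisprove-13480 v1) and void input-restricted in KL (η_KL ≥ 1/2 by the route's own fast-input
      computation ⇒ 2η ≥ 1); χ² has no chain rule, so NO printed percolation theorem covers in-degree-2 vertices in χ².
  (b) In any sign-blind second-moment bookkeeping the per-EDGE covariance factor of a K-eigenmode φ is λ exactly
      (E[φ(V')|V] = λ φ(V)), path PAIRS of total length M number ≍ 2^M × (coincidence), so the dilution series is
      Σ_M (2λ₂)^M × census, parameter 2λ₂(K) = 0.936 — NOT Σ_M (2λ₂²)^M (0.44). The route applies exactly this linear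
      count to the conserved sector ("2λ₁ = 1, critical") but squares λ in the non-conserved sector: inconsistent.
      Cross-check: the keep-or-swap toy of cdisprove-13480 (`not_naivePercolationPrinciple`: c = λ₂² = 1/4 < 1/2 yet
      ZERO forgetting) sits exactly at 2λ₂ = 1 — critical in the corrected currency, as its behaviour demands (§4,
      re-derived here sorry-free: `kosK_sq`, `kosK_form`, `kosRun_perm`).
  (c) So the spectral input the engine needs is `SpectralContractionQuarter` (∃ c < 1/4, ‖Kf‖² ≤ c‖f‖² on measurable
      mean-zero L²(π) ⇔ λ₂(K) < 1/2), numerically true with margin 0.25 − 0.2192 = 0.031 in c (0.5 − 0.46821 = 0.032 in λ₂), and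
      STRICTLY STRONGER than the docked `SpectralContractionR` (`spectralContractionQuarter_imp`); the analytic line on
      file (swap-symmetrisation + Schoenberg ⇒ 0 ≤ K ≤ 1/2 ⇒ c = 1/4) proves SpectralContractionR but lands exactly ON
      the corrected threshold (2λ₂ ≤ 1: critical, series divergent up to the d = 3 transience factor M^{-3/2}), not
      below it. A certified UPPER bound λ₂(K) ≤ 0.47 (operator-norm tail estimate per sector) becomes load-bearing.
  (c′) WHERE the near-critical value lives (exact sector table, this seat, galerkin/sectors.py, kit j007192; Ritz values
      converged in radial degree ≤ 6): sup ⟨Kf,f⟩/‖f‖² over mean-zero f = 0.46821 is attained in the ℓ = 0 RADIAL sector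
      by an energy-like mode (energy itself: 7/15 = 0.46667); ℓ = 1: 0.43294 (momentum itself 3/7 = 0.42857); ℓ = 2:
      0.20448; ℓ = 3: 0.11249; ℓ = 4: 0.0701; ℓ = 5: 0.047; ℓ = 6: 0.032. ON THE ORTHOGONAL COMPLEMENT OF THE COLLISION
      INVARIANTS (1, v, |v|²): ℓ = 0 ⊥ {1, |v|²}: 0.30999; ℓ = 1 ⊥ v: 0.29921; so ‖K‖ off the invariants ≈ 0.310 and the
      corrected dilution parameter of genuinely NON-conserved content is 2 × 0.310 = 0.62 — comfortably subcritical —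
      while the route's near-critical 2 × 0.468 = 0.94 belongs to an energy-like mode, i.e. to the conserved sector the
      route itself declares critical ("Euler lives on the Kesten–Stigum line"). HENCE the spectral crux is aimed at the
      wrong CLASS as well as the wrong POWER: what steps (iii)–(iv) (and both competing cards: coalescent-ring-response
      "‖K‖ ≤ ½ on (1,v,|v|²)^⊥", local-kac-gap-shadow "‖K‖ < 1 off the invariants") consume is
      `SpectralContractionOffInvariants` (∃ c < 1/4 on measurable f ⊥ 1, v₁, v₂, v₃, |v|²; numerically inf c = 0.310² =
      0.096, margin 0.154), implied by `SpectralContractionQuarter` (`offInvariants_of_quarter`) and numerically far safer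
      than either mean-zero statement; the invariant sector must be carried exactly (projected out at every vertex),
      not diluted.
  (d) The subcriticality margin 0.5 − 0.4682 is ENTIRELY a flux-selection effect: with rate-unweighted (π ⊗ π) parents
      the energy mode is transmitted exactly linearly with coefficient 1/2 from each parent (|V'|² = (|V|²+|W|²)/2 +
      noise): 2 · 1/2 = 1, critical. Partner selection ∝ |v − w| is precisely what a Bayesian network over velocities
      cannot encode (the DAG depends on the states), so the idealised network of step (i) is critical and the real one
      is subcritical only through the selection bias the idealisation discards.

* **F4 — why the crux resists disproof.** Believed TRUE as a proposition: its conclusion ContactChaos is local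
  equilibrium of pre-collisional contact statistics at macroscopic resolution (deviations O(Kn), Kn = ℓ/1 =
  ε/(πσ³) → 0 as N → ∞ at fixed σ; under the invariant Gibbs law exact: positions ⊥ velocities; shock layers have
  space-time volume O(ℓ) → 0 and the defect is tested against continuous bounded χ·Ψ), so no physical counterexample is
  expected; and it is vacuous as filed (F2). The MECHANISM is what F3/F5 and the 13478 record put in doubt.

### Cycle 2 (2026-08-16)

* **F5 — `SpectralContractionR` is not load-bearing at ANY constant; the object the crux does not name is the CROSS
  operator `K̃ f(v) = E[f(w′) | v]` (§6, PROVED finite shadow; §6b).** A collision vertex has two out-edges; a lineage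
  census weighs a step by `K` (stay on the sphere) or `K̃` (cross to the partner), so the sign-blind dilution parameter
  per generation is `ρ(K) + ρ(K̃)`, invisible to any hypothesis on `K` alone. Keep(p)/swap(1−p) family on `Fin n`
  (`kspK`, `kspKx`): on mean-zero `f`, `K = p·id`, `K̃ = (1−p)·id`, so `‖Kf‖² = p²‖f‖²` (`kspK_sq`: the SHAPE of
  SpectralContractionR with any c = p² > 0), `2ρ(K) = 2p < 1` (`kspK_form`: even cycle 1's corrected single-sphere
  criterion F3(b) is met for p < 1/2), yet `ρ(K) + ρ(K̃) = 1` (`kspK_add_kspKx_form`): critical, and the dynamics forgets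
  NOTHING (`kosRun_perm`, any coin bias); joint-parent ratio `p² + (1−p)² ≥ 1/2` (`kspJoint_sq`, `half_le_jointCoeff`),
  `= 1/2` iff p = 1/2 (`jointCoeff_eq_half_iff`, §4's keep-or-swap); `exists_ksp_below`: for every c > 0 a member with
  p² < c. CORRECTION to F3(b): "per-edge factor λ, in-degree 2 ⇒ Σ(2λ)^M" silently used `K̃ = K`; the honest abstract
  parameter is `ρ(K) + ρ(K̃)`. For HARD SPHERES `K̃ = K`: `w′` is the antipode of `v′` on the collision sphere
  (`collide_snd_eq_cm_sub`, `collide_fst_sub_cm_eq_neg`, `collide_fst_swap`, PROVED) and the outgoing direction is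
  uniform under the flux law (§5b) — typed claim `CrossOpEqOp` (Grad's symmetry of the two gain terms; prover's tool in
  tree: `lintegral_gain_eq_carleman`). So F3's numbers stand (parameter 2λ₂(K) = 0.936, load-bearing constant
  λ₂(K) < 1/2 ⇔ `SpectralContractionQuarter`, comfortable off the invariants), but the honest spectral dock of a
  re-filed engine is the PAIR `CrossOpEqOp ∧ SpectralContractionQuarter` (or `… ∧ SpectralContractionOffInvariants`
  with the invariant sector carried), and `SpectralContractionR` can be dropped without loss: mutation verdict
  "hypothesis decorative". (The planner caveat CAVEAT-PercolationClosesChaos-13914.md — "the lever is one-step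
  ergodicity of the JOINT pair channel modulo (v+w, |v−w|)" — is the same fact seen from the pair: hard spheres
  resample the relative direction uniformly, keep/swap only permutes it.)

* **F6 — the target's orientation conventions are mutually consistent (§7, PROVED `contactMark_inner_pos`).** The marks
  `(ω, v, w) = (ε⁻¹(x_i − x_j), reflectVel (x_i − x_j) (v_i(s), v_j(s)))` that `ContactChaos` feeds to Ψ are
  PRE-collisional (right-continuous trajectories, `IsHardSphereTrajectory.binary`) and satisfy `⟪w − v, ω⟫ > 0`, the
  support of the reference weight `hardSphereKernel (w, v) ω = ((w−v)·ω)₊` of `B^Ψ_r`. So the cheap kill "Ψ odd under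
  ω ↦ −ω makes the cross-ratio defect O(1) in equilibrium" is NOT available: both sides of the defect live on the same
  (incoming) hemisphere. (Checked symbol by symbol against the `let`-block of `ContactChaos`: `pv`, `Θ`, `Kc`.)

* **F7 — kill attempt on the corrected constant (is λ₂(K) ≥ 1/2 after all?) with LOCALISED radial trial functions:
  FAILED, λ₂ stands at 0.46821.** Cycle 1's Ritz spaces were polynomials of degree ≤ 6 (smooth, global); a thin or
  high-energy radial mode nearly orthogonal to them could in principle carry a larger quotient. Exact t-reduction of F3
  (`⟨Kf,f⟩ = E[g(a,b)²]`, `g = E_t[φ(a+b+2√(ab)t)]` done in closed form, a ~ Γ(3/2), b ~ Γ(2) by composite Gauss–Legendre,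
  200² nodes, values stable to 1e-7 under refinement; `galerkin/radial_ritz_pure.py`, local run, log `ritz_25_8.log`;
  numpy twin queued as kit j008883): sup of the mean-zero ℓ = 0 Rayleigh quotient over Gaussian speed-bumps
  (21–41 functions, centres 0…9 thermal speeds, widths 0.16–0.40) = 0.4682139 (cycle-1 exact-rational deg-6 value
  0.468212; energy alone 7/15 = 0.46667 reproduced to 1e-8); ⊥{1, |v|²}: 0.3099922 (cycle 1: 0.30999); second radial
  eigenvalue 0.30889. Single localised probes (mean-corrected bump at speed c, width h): c = 3: 0.199/0.314/0.409
  (h = 0.15/0.3/0.6); c = 4: 0.181/0.284/0.401; c = 5: 0.141/0.217/0.322; c = 6: 0.112/0.166/0.246; c = 8: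
  0.075/0.106/0.151; c = 10: 0.054/0.073/0.101 — decaying like 1/E, as the L²(π) weighting predicts (a fast sphere's
  energy is spread uniformly on [0, E] by one collision, and π's Gaussian tail confines the overlap to E′ = E − O(1)).
  ℓ = 1 sector (f = φ(|v|²)v_x; `⟨Kf,f⟩ = ⅓E[a g² + 2√(ab) g h + b h²]`, `h = E_t[t φ]`, using E_ψ[u·n | t, t′] = t t′;
  `galerkin/ritz_ell1.py`, same quadrature, momentum 3/7 reproduced to 1e-8): sup over 21–33 speed-bumps = 0.4329384
  (cycle 1: 0.43294), ⊥ v: 0.2992078 (cycle 1: 0.29921); localised probes c = 3…8: ≤ 0.378 and decaying with energy.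
  So no localised mode approaches 1/2 in ℓ ≤ 1; margin 0.5 − 0.46821 = 0.0318 unchanged; ℓ ≥ 2 not re-probed (cycle-1
  values ≤ 0.2045, margin ≥ 0.29). What a PROOF of `SpectralContractionQuarter` still lacks is an operator-norm tail
  bound, not a better lower bound. (`CrossOpEqOp` MC sanity, local: E[v_x(|v′|² − |w′|²)] = +0.0002 ± 0.0031 over
  3·10⁶ flux-law samples, 8×8 panel max |z| = 2.7 at 10⁶; numpy twins kit j008883 / j009163 queued, auto-attach.)

* **F8 — shapes of a re-filed engine that this record (with the 13478 record and the r1 triage panel) already sinks.**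
  For ideators/planners re-docking the crux together with the kick repair:
  (D1) any kick hypothesis asserting o(1)-fairness (N → ∞, σ fixed) of the impact vector given a σ-algebra that contains
       the PARTNER'S PREVIOUS KICK (two-snapshot typed past, cluster/filtration forms, skeleton-with-times forms): false at
       O(σ³) per vertex by static third-body shielding (F2; 13478 SHIELDING.md `three_sphere_cap`); equilibrium-consistent,
       so it must be booked as "→ its Gibbs-Palm value", never "→ flux-uniform";
  (D2) any spectral hypothesis on the same-sphere operator K alone (R, Quarter, OffInvariants, a gap): decorative for a
       dilution census (F5 `exists_ksp_below`); the census needs `CrossOpEqOp`-type pair structure plus λ₂(K) < 1/2;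
  (D3) any fresh/ring or near/far split with each sector "→ 0" separately: false under the invariant Gibbs law (route
       file "Deliberately NOT filed"; TRIAGE-r1-3 §B on card fair-emission-shell-transfer);
  (D4) `Synchronisation(κ)` = N-uniform exponential synchronisation of EVERY cell-wise matched co-driven ghost: false
       (TRIAGE-r1-3 §C smooth sub-cell ghost; the mean channel `D′_v + D′_w = D_v + D_w` is critical at every scale —
       the same 2λ₁ = 1 criticality as F3(d)/§5b `norm_sq_collide_fst`);
  (D5) a percolation/Bayesian-network reduction fed by `KickMacro` (fairness given (v, w, F_r) only): not available —
       the network needs conditional independence given lineage histories, which is (D1)'s σ-algebra; KickMacro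
       (plausibly TRUE: exact in equilibrium by isotropy of the contact pair correlation, O(Kn) off it) can only pay
       macroscopic parts of swap terms (card stein-lindeberg-kick-swap's use).
  Not sunk: `CrossOpEqOp ∧ SpectralContractionQuarter` as the spectral dock; Kick booked against Gibbs-Palm values with an
  explicit ring/short-flight compensation term; transverse (not full) synchronisation.

### Cycle 3 (2026-08-16; line `stein-lindeberg-kick-swap` PICKED, lead's skeleton v2 d797db74 with six stubs)

* **F9 — `-- Targets`: the six stubs of skeleton v2 survive every cheap attack of this seat too (§8; concurring with drefute
  v1/v2: 0 stub-false, 0 stub-misstated).** Independent checks, all on the typed objects: `pairAt` and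
  `Alexander.incomingPairs` BOTH order the pair `i < j` (the asymmetric rule `kickAt`/`kmNormal` — re-place the larger
  label — is the same in the swap vocabulary and in `Z*`); `freeExitTime` of an incoming contact configuration is `0`
  (`sInf` over `t ≥ 0`), so the `Driven` restart at `preAt z k` kicks immediately, as the telescoping wants;
  `nthCollisionTime … 0 0` is the first collision STRICTLY after `0`, matching `Finset.range (numColl …)` over `(0, τ]`;
  on good orbits collisions are binary and strictly incoming (`IsHardSphereTrajectory.binary`,
  `inner_sepVec_preVel_neg`), so (i) there are no grazing terms, and (ii) the admissible set of every realised collision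
  contains a hemisphere-neighbourhood of the true normal (a flux-null admissible set needs a third sphere touching the
  re-placed partner = a multiple contact): the two junk conventions of S3a (`restrictedMean = 0·…` on flux-null sets,
  sampler failure ↦ true normal) never fire on good orbits, not merely on an `lG`-null stratum. ONE NEW ATTACK on S2
  (`OneKickInfluence`, the only stub with independent falsifiable content), in the regime τ > shock-formation time at a
  macroscopic resolution r with `D_∞(r)` on the `φ_η`-ramp: could IN-SHOCK kicks (Campbell mass ≍ N·Area·(τ − t*), i.e.
  a fraction `≍ Kn` of all collisions) have influence `≍ 1/(Nη)` instead of `≍ ℓ/(N r η)` — which would make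
  `E Σ_k infl_k 1{infl_k > Cε/(N+1)} ≍ Area·(τ−t*)/η`, N-independent, and S2 FALSE as typed? NO: a kick swap conserves pair
  momentum and energy exactly (`outgoing_momentum_eq/energy_eq`), so its hydrodynamic projection is `−∂ₓG` with `G`
  supported within `O(ℓ)`; for a Lax shock the `n − 1` outgoing wave monopoles `a_j` and the asymptotic shock shift `δX`
  solve `δX·[U] + Σ_j a_j r_j = ∫h = 0` with `{[U], r_j}` independent (Majda's stability determinant), hence ALL vanish:
  the far field of an in-shock kick is again a zero-monopole wavelet of width `ℓ_s ≍ ℓ` per family, influence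
  `O(ℓ_s/(N r η))` like everywhere else (transients: `O(1/N)` amplitude for time `O(ℓ_s/c)`, negligible after time
  integration). So shocks do not break S2; recorded so that no later seat retries it. WHERE S2's content lives: at the
  CONSUMED resolutions `r < r₀(η)` (`|D_∞(r)| < η/2`) `swapValue_k` is a large-deviation tail of BOTH gases and the
  influences are differences of exponentially small numbers — S2 is nearly free there GIVEN concentration of `Z*` (S1's
  business); the `O(ℓ/(N r η σ³))` budget is only met on the ramp `|D_∞(r)| ∈ (η, 2η)` at macroscopic r, which the
  composition never visits. If the ramp regime ever obstructs the S2 prover, `∃ r₁ ∀ r < r₁` composes (drefute).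

* **F10 — generality audit of the TARGET (and of S1/S3b/Kick, which copy its quantifier prefix): stronger than the summit
  consumes, still believed true, but it forbids a whole proof style (§9).** (a) `ContactChaos` asks resolution-`r` chaos
  for ALL continuous positive profiles and ALL horizons τ > 0, whereas the dock `KineticClosure` and the conjunct
  `HydrodynamicLimit` only ever evaluate chaos along a CLASSICAL hard-sphere-Euler solution on `[0, T)`
  (`IsHardSphereEulerSolution σ T ρ u θ`, `t ∈ Ico 0 T`): beyond the first shock and for rough data the target is
  surplus. (b) For rough continuous data the `N → ∞` behaviour at fixed τ is NOT expected to be deterministic at all: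
  for a cusp shear `u₀ = U·sign(y)|y|^α e_x` (α < 1, smooth cutoff, constant `a₀, θ₀`, `U ≪ c_s`) the Kelvin–Helmholtz
  growth rate at wavenumber `k` is `≍ U k^{1−α} → ∞`, thermal seeds of relative size `(Nλ³)^{−1/2}` at `λ = 1/k` reach
  order one after time `≍ k^{α−1} log(N k^{−3})/U → 0` for `k = N^β` below the viscous cutoff `k ≲ N^{1/(3(1+α))}`
  (`ν ≍ ℓ v̄ ≍ N^{−1/3}`): Lorenz's spontaneous-stochasticity scenario — numerically established for the singular shear
  layer, with a UNIVERSAL macroscopic law "triggered by, but not sensitive to" the micro-scale noise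
  (Thalabard–Bec–Mailybaev, Commun. Phys. 3:122 (2020), doi:10.1038/s42005-020-0391-6, arXiv:2004.08908 p. 1–2), and
  argued to be fed by THERMAL noise within a few eddy turnovers (Bandak–Mailybaev–Eyink–Goldenfeld, arXiv:2401.13881).
  For Lipschitz profiles growth rates are bounded and seeds `≍ N^{−1/2}` cannot reach order one in fixed τ: the limit is
  the (possibly unstable) Euler solution. (c) NOT a counterexample to the target: its reference `B^Ψ_r` is built from
  the empirical fields themselves, so the limiting defect is a SUB-`r`-VARIANCE functional, `D_∞(r) = O(S₂(r))` with
  `S₂` the second-order structure function of the (random) limit fields, `→ 0` as `r → 0` for every finite-energy field —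
  exactly what `∃ r₀ ∀ r < r₀` (after `N → ∞`) asks; and local Maxwellianity survives a developed cascade because the
  dissipation scale stays far above the mean free path (`η_K/ℓ ≍ (v̄³/(ε_d ℓ))^{1/4} → ∞`, so `Kn_local → 0`). F4 stands.
  (d) CONSEQUENCE for provers of ContactChaos / S1 `FairGasContactChaos` / S3b: no proof may pass through convergence
  to a deterministic PDE solution, nor through relative entropy around a smooth Euler profile (Yau / Olla–Varadhan–Yau
  need `C¹⁺` solutions — unavailable at `t = 0⁺` for rough data and after the first shock for all data); the argument
  must be law-level at resolution `r` against the self-referential reference. drefute's fixed-`r` sandwich for S3b ("the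
  two gases share `D_∞(r)`") is safe for Lipschitz profiles before shocks; for rough data it turns into the conjectural
  universality of the spontaneously stochastic law with respect to the microscopic noise (true kicks vs `Z*`'s dice) —
  an open physics question, not a lemma. (e) Cheap planner repair, should the surplus generality ever be what fails:
  restrict the profile class / horizon of `ContactChaos` (and of S1, S3b, Kick) to the classical window the summit
  consumes; `closes` composes unchanged.

* **F11 — `CrossOpEqOp` (F5) is PRINTED, and it is a `d = 3` accident (§6c PROVED; Negative/OutgoingDirectionShadow.lean, p75913).**
  Cercignani, *The Boltzmann Equation and Its Applications* (1988) Ch. IV §5, Eqs. (5.5)–(5.7): rotating `n` through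
  `π/2` in the collision plane (`θ → π/2 − θ`, `ε → ε ± π`, unit Jacobian) maps `ξ′_*` to `ξ′`, so
  `K₂h = (2/m)∫ f₀ h(ξ′) B̄`, `B̄(θ) = B(θ) + B(π/2 − θ)`; for rigid spheres `B ∝ V sin θ cos θ` is symmetric, the two gain
  terms are EQUAL: `K̃ = K`. One-variable shadow, kernel-checked: with `t = −cos 2θ` the outgoing cosine
  (`inner_half_sub_reflect`), the `d = 3` flux law `∝ sin 2θ dθ` makes `t` UNIFORM on `[−1,1]`
  (`integral_comp_outgoingCos_d3`, first moment `0`: `flux_moment_cos_two_mul_d3`), while the `d = 2` flux law `cos θ dθ`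
  gives `∫cos 2θ cos θ = 2/3`, mean `1/3 ≠ 0` (`flux_moment_cos_two_mul_d2`): hard DISKS do not scatter isotropically,
  the law of `t` is not symmetric, `E[f(w′)|v] ≠ E[f(v′)|v]` already for `f` linear in the direction — the
  dimension-free strengthening of `CrossOpEqOp`/`TwoOutputFormEqK` is FALSE, so a prover must not attempt them over the
  tree's dimension-generic `EuclideanSpace ℝ d` kinetic files; and for `d = 2` engines the honest parameter
  `ρ(K) + ρ(K̃)` (F5) genuinely needs both operators.

### Cycle 4 (2026-08-16; rev 4 = stmt-14915 over `KickFairRelEquilibrium`; seat `refuter-cdisprove-stmt-AtomisticToContinuum-14915-0`; line `Sketch` = docking A of card velocity-blind-placement, PICKED 10:29Z, skeleton v1 `Lines/Sketch.lean` 10:32Z with stubs `stub_velocityBlindPlacement`, `stub_localMaxwellian`, `stub_subMeanFreeTimeWindow`; its vocabulary is LANDED as `Literature.MathematicalPhysics.KineticTheory.VelocityBlindPlacement`, imported here)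

* **F12 — anatomy re-certified (§1).** The rev-3 text of this file stopped elaborating at 06:46Z when `KickIsotropyInfo`
  left the route file (`lean check` of the published file: rc 1, 5 errors, all `Unknown identifier KickIsotropyInfo`);
  §1 now names `KickFairRelEquilibrium` (KFRE): `not_crux_iff : ¬crux ↔ KFRE ∧ SpectralContractionR ∧ ¬ContactChaos`,
  `crux_of_contactChaos`, `crux_of_not_kickFairRelEquilibrium`, `crux_of_not_spectralContractionR`, the two `Without`
  docks and their `not_…_iff`. Moral unchanged (F1): a kill = proofs of cruxes 2 and 3 + a refutation of the target; no
  `_false_without_` theorem can exist for an implication between open statements (`not_withoutKick_iff`).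

* **F13 — the vacuity channel (F2) is RE-OPENED for rev 4, at the physics level, not by junk (§2).** rattack-14899
  (CRUX-ATTACK.md 07:03Z) is right that KFRE is not junk-refutable (`g ≡ c` only tests measurability of the good-set-cut
  past map). But the 14914 record written next (Cruxes/KickFairRelEquilibrium/Analysis-r1-k1.md §F3–F4, ideator 1;
  lead-14914 PICKED.md: "I concur with the mechanism at the physics level", clustering algebra re-checked there) finds
  the decl FALSE AS TYPED at every fixed cell size `r`, and this seat re-derived it independently before reading it:
  `G | σ(past)` is intra-cell UNIFORM (homogeneous invariant law conditioned on cell counts and exact velocities; the two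
  snapshots pin positions only up to crossing slabs of width `≍ ℓ ≪ r`), while `LG_s | σ(past)` carries the smooth
  sub-cell local-equilibrium log-gradient `α = ∇ₓ log f(x, v; s) = O(1)`; third-body (shield / ring) events at scale `ε`
  are CO-LOCATION events of two tilted sub-cell positions, so their conditional odds under `LG_s` vs `G` differ by
  `1 + (r²/12)(α_i + α_q)·α_l + O(r³)` — for a pure density gradient `1 + (r²/6)|∇log ρ|² ≥ 1`, SIGN-DEFINITE (finite
  shadow PROVED, §2: `colocation_excess`, `colocation_excess_strict` via `lagrange_identity` — two independent draws from a
  tilted sub-cell profile coincide with probability `Σa²/(Σa)² ≥ 1/n`, strictly unless the profile is constant, so no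
  cancellation "on average over cells" is available); a third body changes the kick LAW (static Enskog shielding, the
  13478 record), hence `Δ_k = E_LG[g | past] − κ_k ≍ s₁ · m̄ · (r²/6)|∇log f|² · ‖g‖`, `m̄ ≈ 56φ` the shell occupation,
  `s₁ ∈ [0.0068, 0.1]` the per-neighbour shift of the kick law (14914 MC), N-INDEPENDENT; with `h = sign Δ(past)`
  (admissible: past-measurable, `|h| ≤ 1`) `E_LG S_h ≍ π σ³ v̄_rel τ · Δ ≈ 7.1 σ³ τ · Δ` — e.g. `Δ ≈ 10⁻⁵…10⁻⁴` and
  `E_LG S_h ≈ 2·10⁻⁶ … 3·10⁻⁵` at σ = 0.3 (φ = 0.014, m̄ = 0.79), r = 0.1, τ = |∇log f| = 1 — so for `δ` below that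
  floor no `N₀` exists: the decl puts `∀ r ∀ δ ∃ N₀` where the target
  (and VBP, LMP below) put `∀ δ ∃ r₀ ∀ r < r₀ ∃ N₀`. Consequences HERE: (i) `crux_of_not_kickFairRelEquilibrium` — the
  dock is again plausibly TRUE EX FALSO: nothing for a disprover to kill, and nothing landable either (`¬KFRE` needs the
  positive-time sub-cell LE structure of the deterministic flow; 14914's `stub_eqKickTail_false_of_<H>` programme is the
  nearest landable object and it kills their LINE, not the decl); (ii) the line's first stub
  `stub_velocityBlindPlacement : KFRE → VBP` inherits the vacuity — its honest content is VBP itself; (iii) the repair on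
  file (14914 R2: cells `r_N`, `ε ≪ r_N ≪ N^{-1/6}`; only the let-chain's `Torus.coarseCell r` changes) leaves THIS line
  untouched: VBP's closure is its own `N → ∞ then r → 0` and it consumes KFRE only nominally. Planner: 14915 will have
  to be re-filed together with the R2-restated 14914 (third joint re-filing of this pair: 13480/13914/14915).

* **F14 — `-- Line Sketch`, typed-object audit (§10, all PROVED on the landed vocabulary).** (a) Normalisation:
  `(N+1)·ℓ_N³ = (π³σ⁶)⁻¹` (`card_mul_meanFreePath_cube`; `ℓ_N = (π(N+1)ε_N²)⁻¹`, `ε_N = σ(N+1)^{-1/3}`): an `ℓ`-ball holds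
  `(4/3)π ρ (N+1)ℓ³ ≈ 0.135 ρ σ⁻⁶` particles, N-independent (≈ 185 ρ at σ = 0.3, ≈ 1.4·10⁵ ρ at σ = 0.1) — `closeStat` is
  an O(1) object and its `((N+1)ℓ³)^k` normalisation is the right one ✓. (b) VBP IS VOID ON THE PLACEMENT MARGINAL:
  for a constant label test the cross-ratio defect vanishes for EVERY configuration, flow, geometry test and localiser
  (`vbpDefect_const`, from `closeStat_const`, `allStat_const`); `k = 0` likewise. VBP constrains the label law GIVEN the
  empirical geometry `Close_{g,1}` and never the geometry itself — load-bearing for F15 (d1). (c) LMP's Maxwellian is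
  never evaluated at a negative temperature: `poolTemperature_nonneg` for `r > 0` (weighted Cauchy–Schwarz
  `‖Σ bᵢvᵢ‖² ≤ (Σ bᵢ)(Σ bᵢ‖vᵢ‖²)`, `norm_sum_smul_sq_le`, `bump_nonneg`); `θ = 0` exactly for empty or cold pools, where
  `localMaxwellian 1 0 u v = 0` (`localMaxwellian_one_zero`: the junk value is 0, not a Dirac mass at `u`), so there the
  integrand of `maxwellDefect` is `poolTest F` itself — harmless in the typed order (`r` fixed, `N → ∞`: pools hold
  `≍ ρ N r³` particles), a trap for any `r_N → 0` re-typing. (d) Bounded label tests miss the flux moment: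
  `boundedTests_miss_fluxMoment` — the two-point laws `(1 − 1/(n+1))δ₀ + (1/(n+1))δ_{n+1}` converge on every bounded
  test to their `δ₀` values while the flux moment `Σ pₐ p_b |xₐ − x_b| → 2 ≠ 0`: in-probability statements over bounded
  `F` (VBP, LMP) do not control a flux-weighted collision functional (`K_N`) without a tail input (F15 d2).

* **F15 — `-- Line Sketch`, verdicts (§11).** NOTHING IN THE LINE IS FALSE; it is true-but-not-cutting, like F9's.
  `stub_velocityBlindPlacement`: vacuous-by-antecedent (F13); its conclusion VBP is believed TRUE and is not cheaply
  attackable (positions ⊥ labels under local Gibbs; the pre-collisional / post-collisional asymmetry of receding pairs at scale `ℓ`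
  cancels EXACTLY under detailed balance and survives only at `O(Kn)` through the Chapman–Enskog correction; static
  contact structure is label-blind in LE; the fixed-`r` "mixture of products ≠ product of mixtures" defect `O(r²|∇u|²)`
  is absorbed by `∃ r₀` FIRST — the quantifier order KFRE lacks). `stub_localMaxwellian`: `SpectralContractionR` is
  DECORATIVE once more (D2/F5: no constant of the tagged-sphere operator enters an in-probability local-equilibrium
  statement for the deterministic flow — an H-theorem-class statement at fixed σ); LMP believed true (t = 0 mixture defect
  `O(r²)` absorbed by `∃ r₀`). `stub_subMeanFreeTimeWindow` — registered as the "provable-now transfer" carrying no open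
  content — is NOT CLOSABLE AS TYPED; two antecedents are consumed silently: (d1) GEOMETRY. W4 of the card evaluates the
  window functional "for hard-core-uniform placement of the ACTUAL labels", i.e. against the Gibbs-positional reference,
  but the typed VBP is void on the placement marginal (F14 b) and the lead's reshape keeps geometry EMPIRICAL on purpose
  ("never identified with a hard-core reference law"). Through Boltzmann's cylinder (`lintegral_collisionCylinder`) the
  contact measure predicted from a label-blind snapshot is `Λ(ω, v, w) · ((w−v)·ω)₊ dω μ̄(dv) μ̄(dw)` with
  `Λ = ∫₀^{a t_ℓ} G(−(εω + (w−v)t)/ℓ) dt`, `G` the EMPIRICAL pair-separation density around the anchor (in `ℓ` units):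
  angular structure of `G` at scales `ε…aℓ` makes `Λ` depend on the direction of `w − v`, radial structure on `|w − v|`
  and `ω`, while `ContactChaos` frees only a SCALAR rate `λ(t, x)` (its reference `B^Ψ_r` fixes the angular kernel
  `hardSphereKernel (w, v) ω`; F6). So the transfer consumes a third snapshot property, HUCP — "hard-core-uniform close
  placement in probability": the `(k+1)`-point geometry statistics `Close_{g,1}` at scales `≤ Aℓ` converge to their
  values under hard-core-uniform placement at the pool's density (same cross-ratio / `N → ∞ then r → 0` format; LE class
  exactly like VBP, deviation `O(Kn)` — it is the kinetic stress anisotropy one scale down); without it W4's "constants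
  CANCEL in the cross-ratio" is false (they are functions of `(ω, v, w)`, not constants). (d2) TAILS. VBP/LMP test bounded
  `F`; `K_N` counts every collision and its references `A_r`, `B^Ψ_r` are flux moments of the pool: window collision
  counts and fast pairs need uniform integrability under the EVOLVED law, which is the content of #7a
  `CollisionMomentBound` (equilibrium exponential moments of window counts + entropy inequality;
  HighMomentumCutoffBarrierNarrow; F14 d is the finite shadow) — a route decl, importable BY NAME as an antecedent
  instead of being re-proved inside the stub. (d3) Product tests `g(y)·F(v, w)` versus the joint cylinder indicator
  `1{y ∈ Cyl(v, w)}`: Stone–Weierstrass on compacts, fine GIVEN (d2). Corrected signature proposed to the lead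
  (stub-misstated note on the item): `stub_subMeanFreeTimeWindow : VBP → HUCP → LMP → CollisionMomentBound → ContactChaos`,
  with HUCP registered as a fourth stub (open, LE class) — or VBP strengthened to the card's original label-AND-geometry
  form. Until then the line's bookkeeping ("all open content in stubs 1–2") undercounts by one LE-class statement.

### Cycle 5 (2026-08-16; rev 12 = stmt-15178 over `KickFairRelEquilibriumMeso`; seat `refuter-cdisprove-stmt-AtomisticToContinuum-15178-0`; crux 3 `SpectralContractionR` PROVED 13:14Z; line `Sketch` = card ergodic-window-is-von-neumann PICKED 14:01Z, skeleton `Lines/Sketch.lean` 14:08Z, 7 stubs registered 14:07Z)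

* **F16 — anatomy at rev 12 (§1, §1b re-cut; PROVED).** The rev-4 §1 stopped elaborating at 12:31Z when
  `KickFairRelEquilibrium` left the route file (rc 1, 4 × `Unknown identifier`). Now: `not_crux_iff : ¬crux ↔ KMeso ∧
  SpecR ∧ ¬ContactChaos`; and since crux 3 is a THEOREM (`spectralContractionR_proved`, alias of
  `…SwapSymmetrisation.SpectralContractionR_proof`, c = 1/4): `not_crux_iff_rev12 : ¬crux ↔ KMeso ∧ ¬ContactChaos`,
  `crux_iff_kick_imp_target : crux ↔ (KMeso → ContactChaos)`, `withoutKick_iff_target : (crux without Kick) ↔ ContactChaos`,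
  `withoutSpectral_iff_crux` (the spectral hypothesis is now FORMALLY decorative — F3/F5 had said so for the mechanism),
  `crux_of_not_spectralContractionR` is void (`absurd`). A kill = a PROOF of crux 2 + a REFUTATION of the target; no
  `_false_without_` theorem can exist (`not_withoutKick_iff : ¬(crux without Kick) ↔ ¬ContactChaos`). §1b makes the rev-12
  burden explicit: `kickFairRelEquilibriumMeso_iff : KMeso ↔ ∃ rs, AdmissibleCells rs ∧ KickFairAlong rs` (definitional;
  the rev-4 let-chain with `coarseCell (rs N)`, concurring with rattack-15178 `E2.lean`), `crux_iff_forall_cells : crux ↔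
  ∀ rs, AdmissibleCells rs → KickFairAlong rs → ContactChaos` — the engine prover fixes an ARBITRARY admissible sequence and
  then knows only `rs → 0` and `ε_N/rs N → 0` (`tendsto_hsDiameter_div_cells : ε_N/rs_N = σ((N+1)rs_N³)^{-1/3} → 0`, from the
  typed lower edge alone); `admissibleCells_default` ((N+1)^{-1/4} inhabits the window). The UPPER edge `rs ≪ N^{-1/6}` is
  NOT typed (∃ rs: the kick prover's choice) — so `KickFairAlong rs` with `rs → 0` arbitrarily slowly is what a refuter of
  crux 2 must now beat, and what the engine may NOT assume.

* **F17 — the vacuity channel (F2 rev 3, F13 rev 4) is CLOSED at rev 12 as far as the record reaches.** Every kick-law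
  defect on file dies along every admissible sequence: third-body shielding (13478) is equilibrium-present ⇒ inside `κ`
  (relative form); sub-cell clustering (14914, `SubcellClusteringBiasPersists`) is `∝ rs²|∇log ρ|² → 0`; first-order
  activity/temperature tilts across a cell act on the impact vector only through the `ε`-scale relative position,
  `O(ε|∇log a₀|)`, and through the one-generation velocity-history link, `O(ε|∇log θ₀|)` per generation; free-flight
  (Chapman–Enskog) memory is `O(Kn) = O(ℓ) → 0`; geometric pinning is excluded by `ε/rs → 0` (§1b) and velocity-history
  pinning by the two-snapshot count (≈ N/2 resolved collisions < 3(N+1) position unknowns, cells do not change it). No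
  G-cheap, LG-typical, window-surviving O(1) kick bias is known to this seat either. Searched anew: SHOCK LAYERS (width
  `≍ ℓ ≪ rs`) — a cell straddling a shock has an O(1) sub-cell density contrast, so the 14914 co-location defect is
  `O(φ s₁)` per collision there instead of `O(φ s₁ rs²|∇log ρ|²)`, but only in the fraction `≍ Area·rs` of cells touching the
  shock surface: total `∝ rs → 0`; ROUGH / turbulent limit fields (F10 b) — sub-cell contrast `(δρ(rs)/ρ)² = O(S₂(rs))`
  → 0). So for the first time since rev 3 this dock is NOT plausibly vacuous: its content is `KMeso → ContactChaos` proper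
  — believed TRUE as a material implication because its conclusion is (F4/F10), irrefutable short of ¬ContactChaos (F16).
  Nothing for a disprover to kill in the STATEMENT; the cycle's teeth go into the picked line (F18).

* **F18 — `-- Line Sketch` (rev 12, ergodic-window-is-von-neumann; §12; stub notes posted on the item).** Seven stubs;
  verdicts on the typed objects of `Lines/Sketch.lean` (14:08Z):
  (a) `stub_windowDefectLever` — TRUE and provable now (L¹ mean ergodic theorem ⇒ each Birkhoff average → its mean in
      measure ⇒ the polynomial `a₀a₁ − a₂a₃` → `D(means) = 0` in measure; `M = 0` gives `birkhoffAverage = 0`, harmless).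
  (b) `stub_entropyEventTransfer` — TRUE (Donsker–Varadhan / Gibbs variational inequality; `klDiv ≠ ⊤ ⇒ μ ≪ ν`).
  (c) `stub_ergodicShadow` — open content exactly as declared (TimeErgodicKinetic + KWL); the `∃ (Ω, μ, T, F)` placed
      BEFORE `M, η` is NOT junk-exploitable: `Ergodic T μ` + `crossDefect(means) = 0` force the dominating tail to `0` as
      `M → ∞` (that is the lever), and the one-point system (`T = id`, `F ≡ 0`) makes the RIGHT side `δ` — the STRONGEST
      claim, not a free one; `σ ≤ 1/2` ⇔ `φ ≤ π/48 ≈ 0.065`, deep in the fluid phase (had the range reached freezing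
      `φ ≈ 0.494`, the infinite-volume limit of the torus states would be a non-extremal crystal mixture, non-ergodic under
      time shifts, and the stub FALSE there while the line needs only small `σ` — the `1/2` matters and suffices);
      uniformity in `x₀, s₀` is free (translation / flow invariance of `G_N`). No cheap attack; no literature kill
      (time-ergodicity of the infinite low-activity hard-sphere Gibbs state is open, as the card says).
  (d) `stub_dvTransfer` — NOT CLOSABLE FROM ITS TWO HYPOTHESES; a third input is consumed silently. `KineticCellChaosLG`'s
      `B` is COLLISION-WEIGHTED (`collWin 1`, a normalised count of collisions in a kinetic cell-window — unbounded in `z`,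
      bump height `3/(π c³ℓ³)`), so `hE` as typed (`0 ≤ B ≤ 1`) does not even apply to it, and the docstring's own first
      line `E_LG[B] ≤ (H + log E_G e^{λ(N+1)B})/(λ(N+1))` needs `log E_{G_N} exp(λ(N+1)B) ≤ (N+1)·ψ_M(λ)`, i.e.
      (N+1)-EXTENSIVE EXPONENTIAL MOMENTS OF KINETIC-WINDOW COLLISION COUNTS under the invariant law at per-collision rate
      `λ/(Mh)` — the `Λ_τ < ∞` input that is CRUX content elsewhere on the board (`KineticFluxLdDecay` stmt-10967,
      `KineticWindowGronwall` stmt-9282; the landed `…CesaroExpMoment` is only the Hölder-over-windows step the lead also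
      uses), unprinted for deterministic spheres (`HighMomentumCutoffBarrierNarrow`); Hölder over PARTICLES does not give it
      (it raises the rate to `λ(N+1)` on one particle). The card names this honestly (`PoissonBlockBadness` + "Gibbs
      exponential moments of window collision counts"); the skeleton's stub list does not. Two repairs for the lead:
      (i) keep the collision weighting, re-type `hE`/`stub_entropyEventTransfer` for `0 ≤ B` with
      `Integrable (fun x => exp (lam * B x)) ν` in place of `B ≤ 1` (still provable now, same `Measure.tilted` route) AND add
      the window exponential-moment statement under `G_N` as an explicit hypothesis / eighth stub (crux-class, shared with
      10967/9282); or (ii) truncate the weight, `min (collWin 1) K` with `∀ K` in `KineticCellChaosLG`, so that `hE` applies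
      verbatim and the remaining LD content is the BOUNDED-summand spatial concentration the card calls PoissonBlockBadness,
      and pay the `K`-excess ONCE in `stub_kineticDocking` — which then needs LOCAL uniform integrability of collision counts
      under the evolved law, MORE than the borrowed `CollisionMomentBound` (tightness of the total `K_N[1+|v|²+|w|²]` does
      not forbid a macroscopic fraction of collisions in overcrowded cell-windows). Either way one tail statement of barrier
      class is owed and should be a NAMED stub.
  (e) `stub_noMesoscopicOscillation` + `stub_kineticDocking` — JOINT-SUFFICIENCY GAP (finite shadow PROVED, §12
      `integral_hat_mul_heaviside`, `docking_reference_gap`). The target reads its `r`-ball pair fields `A_r, B^Ψ_r` through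
      the TIME MOLLIFIER `bt` (width `r`) CENTRED AT THE COLLISION `(s_c, x_i)` (`Pm`); the typed conjunct compares the cell
      with the INSTANTANEOUS ball field `Pr … (w·Mhℓ) x` at the window start, at ball centres `x` spread over `|x − x₀| < r`
      (`∫x, bump r x₀ x …`). Swapping the order of summation in `D` shows what the docking meets: cell-window `(x₀, w)`
      against `∫ bt(s' − s_w) Pr(s', x₀) ds'` — balls at OTHER TIMES `|s' − s_w| < r`, SAME centre. So as typed the docking
      consumes silently (t) time-regularity over `±r` of the evolved `r`-ball pair fields and (x) a kernel swap at scale `r`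
      (Jensen turns the `b_r(x₀,x)`-average into control against the triple-bump kernel `∫b_r(x₀,x)b_r(p,x)b_r(q,x)dx`, not
      the target's `b_r(p,x₀)b_r(q,x₀)`): both free for continuous macroscopic limits, both FALSE pointwise at a shock
      (the shadow: a unit step read through `bt` is worth `1/2` at the jump for EVERY `r`, the instantaneous reading is `1` —
      the gap does not close as `r → 0`; it is paid only in space-time measure `≍ Area·r`), LE-class in general (rough data,
      F10 b). Corrected signature (posted as stub-misstated): in `NoMesoscopicOscillation` replace
      `∫ x, ∫ x₀, bump r x₀ x * (… |pairWin Ξ … * Pr 1 z (w*(M*h*ℓ)) x − pairWin 1 … * Pr Ξ z (w*(M*h*ℓ)) x|)` by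
      `∫ x₀, (… |pairWin Ξ … * Pm 1 z (w*(M*h*ℓ)) x₀ − pairWin 1 … * Pm Ξ z (w*(M*h*ℓ)) x₀|)` with
      `Pm Th z s₀ x₀ := ∫ s in Set.Icc 0 τ, (r⁻¹ * max (1 − |s − s₀|/r) 0) * Pr Th z s x₀` — literally the target's `Pm`
      at `(s₀, x₀)`; then the only residual offsets are `|s_c − s_w| ≤ Mhℓ`, `|x_i − x₀| ≤ cℓ`, paid DETERMINISTICALLY by the
      Lipschitz moduli of `bt` (`r⁻²`) and `bx` (`3/(πr⁴)`) against the `O(1)` pair-flux mass (energy conservation): `O(ℓ/r)`.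
      The corrected conjunct is exactly as (un)provable as the typed one (same LE class) and is what the target forces.
  (f) `stub_collisionMomentBound` — the route support 15144 by name; nothing to attack inside the line.
  (g) Glue `ergodicWindowN_of_shadow` and the composition are kernel-checked; fine. Smaller remarks: `h` may depend on the
      flow family `Φ` (harmless, flows are a.e.-unique); the docking's "denominators bounded below on cells carrying
      collisions" holds per event up to velocity tails (`collWin 1 / pairWin 1 ≲ 2π³σ⁶c³` per colliding pair by the cone
      bump's Lipschitz modulus) — again a tail input, same owner as (d).

* **F20 — NECKLACE STATES as a probe of every exponential (speed-N) transfer on this crux — and a RETRACTION (§13).** The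
  probe: on `𝕋³`, `k ≈ 1/ε_N = (N+1)^{1/3}/σ` spheres aligned along the closed geodesic `{(x,½,½)}` (free length `G ∈ (0, 2ε)`,
  gaps `g = G/k`), `j` of them carrying an axial pulse of speed `v`, the gas kept out of the `ε`-tube: exact 1D hard-rod dynamics
  inside the good set (head-on equal-mass exchange), `R = j(k−j)v/G` collisions per unit time, marks `(∓x̂,·,·)` only (every
  kinetic cell it threads is BAD for a generic mark test: `Ψ = cos²` reads `1` against the cell's hemispherical flux average `½`).
  Costs under `G_N`: kinetic `jv²/2`; protection `≈ 7σN^{2/3}×(lifetime)`; bookkeeping `O(N^{1/3}log N)`; and ALIGNMENT. The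
  transverse dynamics of a loaded chain is EULER BUCKLING: a passage kicks the transverse velocity of ball `j` by `−(v/ε)(Ly)_j`
  (`L` the lattice Laplacian of the offsets — misaligned balls are pushed further out) and the kicks ACCUMULATE between passages,
  so offsets obey `y¨ = (8g/ε)·(−L/4) y` per passage²: the staggered mode grows by `e^{√(8g/ε)}` PER PASSAGE (momentum flux =
  compressive load), i.e. the stability exponent over a lifetime `τ'` is `E_s ≈ 2√2·vτ'·√(j/(Gε))`, and the alignment cost is
  `≈ c₁ k E_s`, `c₁ ∈ [4/π, 4]` (unstable directions × mode-averaged exponents). RETRACTED (versions 1–2 of this finding,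
  14:40–14:55Z, notes `stubs/dvTransfer-necklace*.md`, and the narrative of `Negative/NecklaceFloor.lean` revs 1–2): they used a
  displacement-only instability model (growth `1 + 4g/ε` per hop, exponent `2vτ'/ε`), under which a necklace sustained over the
  whole horizon had an EXTENSIVE cost `(a x² + b x)(N+1)` and gave the collision-weighted DV transfer of `stub_dvTransfer` an
  `N`-uniform floor. With buckling the cost of holding a window-averaged level `B ≥ x` over the horizon is
  `≥ c₁√2·π·x·τ·σ^{5/2}·(N+1)^{7/6}` WHATEVER `v, τ', j, G` (only the product `vτ'` enters and it is fixed by `x`; bursts are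
  diluted by the window average `W⁻¹Σ_w` and cost `≍ N^{5/3}`): SUPER-EXTENSIVE. So necklaces do NOT obstruct the DV transfer's
  hidden input (F18 d), which stays what F18 (d) called it — untyped, unprinted, plausible; repair (i) there is NOT refuted; the
  kernel-checked §13 lemmas (`exp_mul_measureReal_le_integral_exp` = Chebyshev; `quadraticCost_sup_attained`, `dv_choice_void`,
  `dv_bound_floor`, `necklace_term_ge`, `dv_floor_two_branch` = what an extensive-cost event family `e^{−(N+1)(ax²+bx)}` WOULD do
  to the DV bookkeeping) remain correct mathematics without an instance on this crux. What the probe DOES deliver is F21: for a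
  CUMULATIVE, `ε_N`-weighted, ENERGY-weighted functional a SHORT burst suffices and the buckling bill is sub-extensive.

* **F21 — a fast single-pulse necklace burst VOIDS THE RECORDED PROOF PLAN OF `CollisionMomentBound` (stub
  `stub_collisionMomentBound` = route support stmt-15144; its STATEMENT is untouched) (§14, prose; shadows = §13's Chebyshev
  lemma and the AM–GM shape of `dv_bound_floor`).** The plan on file (route text #7a; F15 d2) is "equilibrium mean by
  stationarity + a SPEED-N upper deviation bound for `K_N[1 + |v_i|² + |v_j|²]` under the invariant law + the entropy inequality
  `H(LG|G) = O(N)`". For the ENERGY-MOMENT part no speed-N bound exists. Take the F20 necklace with ONE pulse (`j = 1`,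
  `G = ε/2`, rate `R = 2v/ε²`) alive for `τ'`: it makes `n = 2vτ'/ε²` head-on collisions each carrying `|v_i|² + |v_j|² = v²`, so
  `K_N[|v_i|²+|v_j|²] ≥ 2εnv²/(N+1) = 4v³τ'/(ε(N+1))`; the level `K₀` fixes `vτ' = K₀ε(N+1)/(4v²)`. Buckling bill:
  `c₁ k E_s = c₁ k·2√2 vτ'/√(Gε) = 4c₁vτ'/ε² = c₁K₀(N+1)/(εv²) = c₁K₀(N+1)^{4/3}/(σv²)`; kinetic bill `v²/2`; optimum
  `v² = √(2c₁K₀/σ)(N+1)^{2/3}`, TOTAL COST `√(2c₁K₀/σ)·(N+1)^{2/3}` — SUB-EXTENSIVE (`c₁ ∈ [4/π, 4]`: coefficient between `1.6√(K₀/σ)`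
  and `2.8√(K₀/σ)`); lifetime `τ' = K₀ε(N+1)/(4v³) ≍ N^{-1/3}` (a few mean free times; protection and bookkeeping `o(N^{2/3})`).
  Numbers at `N = 10⁶, σ = ½, K₀ = 10, c₁ = 2`: ONE ball at `v ≈ 274` thermal speeds threading `200` aligned balls for
  `τ' ≈ 6·10⁻⁴` (66 laps, `1.3·10⁴` head-on collisions, stability exponent `E_s ≈ 93`), total cost `≈ 7.5·10⁴` nats against an
  entropy budget `≍ 10⁶ h`. Hence
      `P_{G_N}(K_N[|v_i|² + |v_j|²] ≥ K₀) ≥ exp(−√(2c₁K₀/σ)(N+1)^{2/3}(1+o(1)))`   for EVERY `K₀`: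
  under the invariant law itself the energy-moment collision functional is heavy-tailed at scale `e^{−N^{2/3}}`, so the entropy
  inequality (`P_LG(A) ≤ (H + log 2)/log(1 + 1/P_G(A)) = O(N)/O(N^{2/3}) → ∞`) transfers NOTHING, and neither does the KL-free
  density domination `LG ≤ Λ^{N+1}G_{θ₁}` (p96578 needs `P_G(A) ≤ e^{−(log Λ + c)(N+1)}`). The COUNT part `K_N[1]` is safe: there
  `vτ' = K₀ε(N+1)/4` is `v`-free in the buckling bill `4c₁vτ'/ε² = c₁K₀(N+1)/ε ≍ N^{4/3}` — super-extensive, and even the optimal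
  many-pulse variant stays `≥` extensive. So the tail input of the kinetic dock must come from the EVOLVED law directly (the
  functional is `≍ (N+1)⁻¹ Σ_i n_i|v_i|²`, third velocity moments ALONG THE FLOW — `HighMomentumCutoffBarrierNarrow` in its
  sharpest form), or the dock must truncate in `|v|` as well and live with a defect measure. `disprover-wanted:` material for
  stmt-15144's provers; posted on this item for the lead (the line borrows 15144 by name, so nothing changes inside the line — but
  "tails by name" now names an item whose only recorded plan is void for its energy part).

* **F19 — why the crux still resists, rev 12 (for the next re-arm).** Statement: irrefutable short of ¬ContactChaos
  (F16), no longer vacuous (F17). Mechanism (engine): unchanged since F3/F5/F8 — the honest spectral dock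
  `CrossOpEqOp ∧ λ₂(K) < 1/2` is now HALF LANDED (`stub_partnerLaw` = CrossOpEqOp's flux-form isotropy and `‖K‖² ≤ 1/4`
  are theorems: 2λ₂ ≤ 1, ON the corrected threshold, convergent with the `M^{-3/2}` transience factor), the census /
  equilibrium-identification steps (iii)–(v) remain unwritten for ANY admissible `rs`. Line: true-but-owing — one tail
  statement (F18 d, hidden input still open after the necklace probe F20; by F21 the borrowed `CollisionMomentBound` has no recorded proof
  plan left for its energy part) and the reference re-typing (F18 e); its open heart (TimeErgodicKinetic, PoissonBlockBadness) is
  declared, not hidden. Not run this cycle (compute-free hub, `disprover-wanted:` material): the card's kit falsifier (2)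
  — equilibrium event-driven MD in kinetic units, `V(M, L′)` saturation/decay and Poisson-sparseness of joint cell badness.

Sections: §1 anatomy (rev 12) · §1b the rev-12 window (PROVED) · §2 vacuity inheritance + co-location excess (PROVED) · §3 consumed spectral input (Quarter, OffInvariants) · §3b siblings (PROVED) · §4 keep-or-swap ·
§5 typed claim TwoOutputFormEqK (statement) + §5b kinematic identities (PROVED) · §6 cross operator K̃: keep(p)/swap family (PROVED) ·
§6b antipode kinematics (PROVED) + typed claim CrossOpEqOp · §6c outgoing-direction shadows d = 3 vs d = 2 (PROVED) · §7 convention audit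
of the target (PROVED) · §8 `-- Targets` rev 3: skeleton v2 stubs of stein-lindeberg-kick-swap (prose verdicts) · §9 generality
audit of the target (prose) · §10 `-- Line Sketch` typed-object audit (PROVED, rev 4) · §11 `-- Line Sketch` stub verdicts (prose, rev 4) ·
§12 `-- Line Sketch` rev 12 (ergodic-window-is-von-neumann): docking-reference gap, finite shadow (PROVED) + verdicts F18 ·
§13 necklace states: the probe, the RETRACTED DV floor, Chebyshev + DV-bookkeeping lemmas (PROVED; F20) ·
§14 a fast single-pulse necklace burst voids the speed-N plan of `CollisionMomentBound` (prose; F21).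

LANDED (importable, kernel-checked, `--supports` this item) under `Summits/…/HydrodynamicLimit/Theorems/PercolationClosesChaos/Negative/`,
namespace `Summit.AtomisticToContinuum.HydrodynamicLimit.Theorems.PercolationClosesChaos.Negative`:
`KeepSwapFamily.lean` (p73539 @8e93176bf323: `kspK`, `kspKx`, `kspK_sq`, `kspK_form`, `kspKx_form`, `kspK_add_kspKx_form`,
`kspJoint_sq`, `half_le_jointCoeff`, `jointCoeff_eq_half_iff`, `exists_ksp_below`, `kspRun_perm` — §4/§6 content) and
`CollisionSphereKinematics.lean` (p74375 @b8903d16a3e7: `collide_fst_eq_cm`, `collide_snd_eq_cm_sub`, `collide_fst_sub_cm_eq_neg`,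
`collide_fst_swap`, `norm_half_sub_reflect`, `inner_half_sub_reflect`, `norm_sq_collide_fst`, `norm_sq_collide_snd`,
`contactMark_inner_pos` — §5b/§6b/§7 content) and `OutgoingDirectionShadow.lean` (cycle 3, p75913 ACCEPTED @16bfeaa4ccae;
`integral_comp_outgoingCos_d3`, `two_mul_sin_two_mul`, `flux_mass_d3`, `flux_moment_cos_two_mul_d3`, `flux_mass_d2`,
`flux_moment_cos_two_mul_d2`, `flux_mean_cos_two_mul_d3_ne_d2` — §6c content). Cycle 4 (§2/§10 content):
`SketchLineTypedAudit.lean` (p99787 ACCEPTED @8ef31b9f8a49: `card_mul_meanFreePath_cube`, `closeStat_const`, `allStat_const`,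
`vbpDefect_const`, `bump_nonneg`, `norm_sum_smul_sq_le`, `poolTemperature_nonneg`, `localMaxwellian_one_zero`),
`WindowTransferTailGap.lean` (p100304 ACCEPTED @6578f61898a9: `boundedTests_miss_fluxMoment`),
`SubcellColocationExcess.lean` (p100849 ACCEPTED @8a78a4f976a1: `colocation_excess`, `lagrange_identity`, `colocation_excess_strict`).
Cycle 5 (§1b/§12/§13 content): `WindowBurden.lean` (p108698 ACCEPTED @674a8369074d: `not_percolationClosesChaos_iff`,
`tendsto_hsDiameter_div_cells`, `window_default_pos`, `window_default_tendsto_zero`, `window_default_tendsto_atTop`,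
`percolationClosesChaos_iff_forall_cells`), `DockingReferenceGap.lean` (p108600 ACCEPTED @35b091ee58d3: `integral_timeHat_mul_heaviside`,
`docking_reference_gap`), `NecklaceFloor.lean` (p109473 @aa4968734865; rev 2 p109726 @7bf4f3c26405 adds `dv_floor_two_branch`; rev 3 p110056
ACCEPTED @5a64501d8b40 = docstring retraction of the floor narrative, declarations verbatim: `exp_mul_measureReal_le_integral_exp`,
`quadraticCost_sup_attained`, `dv_choice_void`, `dv_bound_floor`, `necklace_term_ge`, `dv_floor_two_branch`).
-/

namespace Summit.AtomisticToContinuum.HydrodynamicLimit.Cruxes.PercolationClosesChaos.Disproof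

open Summit.AtomisticToContinuum.HydrodynamicLimit.Theses.InformationPercolationEngine
open scoped BigOperators
open MeasureTheory

/-! ## §1 Logical anatomy at rev 12: what a kill of the crux must contain -/

/-- `SpectralContractionR` (crux 3, stmt-13913) is PROVED in the tree since 2026-08-16 13:14Z
(`Theorems/InformationPercolationEngineSpectralContractionR.lean`, c = 1/4: `λ₂(K)² ≤ 1/4`); alias for this file.
[folklore] -/
theorem spectralContractionR_proved : SpectralContractionR :=
  Summit.AtomisticToContinuum.HydrodynamicLimit.Cruxes.SpectralContractionR.SwapSymmetrisation.SpectralContractionR_proof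

/-- A refutation of the rev-12 crux is exactly: crux 2 (`KickFairRelEquilibriumMeso`) proved, crux 3 proved, AND the
route target refuted. [folklore] -/
theorem not_crux_iff :
    ¬ PercolationClosesChaos ↔ (KickFairRelEquilibriumMeso ∧ SpectralContractionR ∧ ¬ ContactChaos) := by
  unfold PercolationClosesChaos
  tauto

/-- With crux 3 discharged: a kill is `KickFairRelEquilibriumMeso ∧ ¬ ContactChaos`, nothing less. [folklore] -/
theorem not_crux_iff_rev12 : ¬ PercolationClosesChaos ↔ (KickFairRelEquilibriumMeso ∧ ¬ ContactChaos) := by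
  rw [not_crux_iff]
  exact ⟨fun h => ⟨h.1, h.2.2⟩, fun h => ⟨h.1, spectralContractionR_proved, h.2⟩⟩

/-- With crux 3 discharged the crux IS `KickFairRelEquilibriumMeso → ContactChaos`. [folklore] -/
theorem crux_iff_kick_imp_target : PercolationClosesChaos ↔ (KickFairRelEquilibriumMeso → ContactChaos) :=
  ⟨fun h hK => h hK spectralContractionR_proved, fun h hK _ => h hK⟩

/-- The crux is weaker than the target: `ContactChaos` alone closes it (the dock used by the rev-12 line `Sketch`,
card ergodic-window-is-von-neumann, PICKED 14:01Z). [folklore] -/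
theorem crux_of_contactChaos (h : ContactChaos) : PercolationClosesChaos := fun _ _ => h

/-- Ex falso: a landed refutation of the kick crux `KickFairRelEquilibriumMeso` (stmt-15177) would close this dock for
the wrong reason (F2 rev 3 / F13 rev 4 were such channels; at rev 12 no mechanism on file survives the window, F17).
[folklore] -/
theorem crux_of_not_kickFairRelEquilibriumMeso (h : ¬ KickFairRelEquilibriumMeso) : PercolationClosesChaos :=
  fun hK => absurd hK h

/-- Ex falso through crux 3 — now VOID: `SpectralContractionR` is a theorem, so this door is shut for good. [folklore] -/
theorem crux_of_not_spectralContractionR (h : ¬ SpectralContractionR) : PercolationClosesChaos :=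
  absurd spectralContractionR_proved h

/-- LOAD-BEARING ANALYSIS (a), hypothesis `KickFairRelEquilibriumMeso` dropped. [folklore] -/
def PercolationClosesChaosWithoutKick : Prop := SpectralContractionR → ContactChaos

/-- LOAD-BEARING ANALYSIS (a), hypothesis `SpectralContractionR` dropped. [folklore] -/
def PercolationClosesChaosWithoutSpectral : Prop := KickFairRelEquilibriumMeso → ContactChaos

/-- Dropping the kick hypothesis leaves exactly the TARGET (crux 3 being proved): `_false_without_Kick` would be
`¬ ContactChaos`, summit-level negative evidence. [folklore] -/
theorem withoutKick_iff_target : PercolationClosesChaosWithoutKick ↔ ContactChaos :=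
  ⟨fun h => h spectralContractionR_proved, fun h _ => h⟩

/-- Dropping the spectral hypothesis changes NOTHING at rev 12 (it is a theorem): the crux and its spectral-free
weakening are equivalent — `SpectralContractionR` is formally decorative now (F3/F5 said so for the mechanism). [folklore] -/
theorem withoutSpectral_iff_crux : PercolationClosesChaosWithoutSpectral ↔ PercolationClosesChaos :=
  crux_iff_kick_imp_target.symm

/-- So neither `_false_without_` theorem can exist short of `¬ ContactChaos`: recorded so that no later seat spends time
on them. [folklore] -/
theorem not_withoutKick_iff : ¬ PercolationClosesChaosWithoutKick ↔ ¬ ContactChaos :=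
  not_congr withoutKick_iff_target

theorem not_withoutSpectral_iff :
    ¬ PercolationClosesChaosWithoutSpectral ↔ (KickFairRelEquilibriumMeso ∧ ¬ ContactChaos) := by
  rw [withoutSpectral_iff_crux, not_crux_iff_rev12]

theorem crux_of_withoutKick (h : PercolationClosesChaosWithoutKick) : PercolationClosesChaos := fun _ => h

theorem crux_of_withoutSpectral (h : PercolationClosesChaosWithoutSpectral) : PercolationClosesChaos :=
  fun hK _ => h hK

/-! ## §1b The rev-12 window (F16): the engine runs on an ARBITRARY admissible cell sequence, and uses `ε_N / rs N → 0` -/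

section Window

open Filter Topology
open Literature.Analysis.FluidPDE Literature.MathematicalPhysics.KineticTheory
open Literature.MathematicalPhysics.KineticTheory.VelocityBlindPlacement

/-- Admissibility of a cell sequence in `KickFairRelEquilibriumMeso`: positive, `rs N → 0`, `(N+1)·(rs N)³ → ∞`
(only the LOWER edge of the planner's window `ε ≪ rs ≪ N^{-1/6}` is typed; the upper edge is the kick prover's choice). -/
def AdmissibleCells (rs : ℕ → ℝ) : Prop :=
  (∀ N, 0 < rs N) ∧ Tendsto rs atTop (𝓝 0) ∧ Tendsto (fun N : ℕ => ((N : ℝ) + 1) * rs N ^ 3) atTop atTop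

/-- The lower edge in the form the engine consumes: along every admissible sequence the diameter is negligible against
the cell, `ε_N / rs N = σ ((N+1) rs_N³)^{-1/3} → 0` at EVERY fixed `σ` (so the coarse past never pins an impact
vector geometrically). [folklore] -/
theorem tendsto_hsDiameter_div_cells (σ : ℝ) {rs : ℕ → ℝ} (hpos : ∀ N, 0 < rs N)
    (hwin : Tendsto (fun N : ℕ => ((N : ℝ) + 1) * rs N ^ 3) atTop atTop) :
    Tendsto (fun N : ℕ => hsDiameter σ N / rs N) atTop (𝓝 0) := by
  have key : ∀ N : ℕ, hsDiameter σ N / rs N = σ * ((((N : ℝ) + 1) * rs N ^ 3) ^ (-(1 / 3 : ℝ))) := by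
    intro N
    have hN : (0 : ℝ) ≤ (N : ℝ) + 1 := by positivity
    have hr := hpos N
    have h3 : (rs N ^ 3 : ℝ) ^ (-(1 / 3 : ℝ)) = (rs N)⁻¹ := by
      rw [← Real.rpow_natCast (rs N) 3, ← Real.rpow_mul hr.le]
      norm_num
      exact Real.rpow_neg_one (rs N)
    rw [Real.mul_rpow hN (by positivity), h3, hsDiameter]
    push_cast
    ring
  simp_rw [key]
  simpa using ((tendsto_rpow_neg_atTop (by norm_num : (0 : ℝ) < 1 / 3)).comp hwin).const_mul σ

/-- The planner's default sequence `(N+1)^{-1/4}` is admissible (the window is inhabited). [folklore] -/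
theorem admissibleCells_default : AdmissibleCells fun N : ℕ => ((N : ℝ) + 1) ^ (-(1 / 4 : ℝ)) := by
  have hN1 : Tendsto (fun N : ℕ => (N : ℝ) + 1) atTop atTop :=
    tendsto_natCast_atTop_atTop.atTop_add (tendsto_const_nhds (x := (1 : ℝ)))
  refine ⟨fun N => Real.rpow_pos_of_pos (by positivity) _, ?_, ?_⟩
  · exact (tendsto_rpow_neg_atTop (by norm_num : (0 : ℝ) < 1 / 4)).comp hN1
  · have key : ∀ N : ℕ, ((N : ℝ) + 1) * (((N : ℝ) + 1) ^ (-(1 / 4 : ℝ))) ^ 3 = ((N : ℝ) + 1) ^ (1 / 4 : ℝ) := by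
      intro N
      have hN : (0 : ℝ) < (N : ℝ) + 1 := by positivity
      rw [← Real.rpow_natCast _ 3, ← Real.rpow_mul hN.le]
      conv_lhs => rw [show ((N : ℝ) + 1) = ((N : ℝ) + 1) ^ (1 : ℝ) from (Real.rpow_one _).symm]
      rw [← Real.rpow_mul hN.le, ← Real.rpow_add hN]
      norm_num
    simp_rw [key]
    exact (tendsto_rpow_atTop (by norm_num : (0 : ℝ) < 1 / 4)).comp hN1

/-- The typed coarse past of crux 2 (cells + exact velocities of all spheres at the two flight starts, partner label,
the three times). -/
abbrev PastMeso (N : ℕ) : Type :=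
  (((Fin (N + 1) → (Fin 3 → ℤ) × V3) × (Fin (N + 1) → (Fin 3 → ℤ) × V3)) × Fin (N + 1)) × (ℝ × ℝ × ℝ)

open scoped Classical in
/-- The compensated kick sum of `KickFairRelEquilibriumMeso` at cell size `r` — its `let`-chain verbatim (identical to the
rev-4 `kickSumRel` of `Negative/KickFairRelEquilibriumFalseOfSubcellClusteringBias`, whose route decl has left the file). -/
noncomputable def kickSumMeso (σ : ℝ) (N : ℕ) (Φ : Flow σ N) (τ r : ℝ) (g : V3 × V3 × V3 → ℝ)
    (h : Fin (N + 1) → ℕ → PastMeso N → ℝ) (z : Config (N + 1) (Fin 3) T3) : ℝ :=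
  let ε := hsDiameter σ N
  let G : Geometry (Fin 3) T3 := Literature.Analysis.FluidPDE.Torus.geometry (Fin 3)
  let q : T3 → (Fin 3 → ℤ) := Literature.Analysis.FluidPDE.Torus.coarseCell r
  let γ : Config (N + 1) (Fin 3) T3 → ℝ → Config (N + 1) (Fin 3) T3 := fun z s => Φ.flow s z
  let cnt : Config (N + 1) (Fin 3) T3 → Fin (N + 1) → ℕ := fun z i =>
    Set.ncard (collisionTimesOf G ε (γ z) i ∩ Set.Ioc 0 τ)
  let P : Config (N + 1) (Fin 3) T3 → Fin (N + 1) → ℕ → PastMeso N := fun z i n =>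
    if z ∈ Φ.good then
      ((Φ.coarsePastOf q i n z, Φ.nthPartnerOf i n z),
        (flightStart G ε (γ z) 0 i (Φ.nthCollisionTimeOf i n z),
          flightStart G ε (γ z) 0 (Φ.nthPartnerOf i n z) (Φ.nthCollisionTimeOf i n z),
          Φ.nthCollisionTimeOf i n z))
    else (((fun _ => (0, 0), fun _ => (0, 0)), 0), (0, 0, 0))
  let X : Fin (N + 1) → ℕ → Config (N + 1) (Fin 3) T3 → V3 × V3 × V3 := fun i n z =>
    if z ∈ Φ.good then ((Φ.nthRecordOf i n z).impactVec, (Φ.nthRecordOf i n z).preVel) else 0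
  let κ : Fin (N + 1) → ℕ → Config (N + 1) (Fin 3) T3 → ℝ := fun i n =>
    MeasureTheory.condExp (MeasurableSpace.comap (fun z => P z i n) inferInstance)
      (localGibbsLaw σ (fun _ => 1) (fun _ => 0) (fun _ => 1) N Φ) (fun z => g (X i n z))
  ε / (N + 1 : ℝ) * ∑ i : Fin (N + 1), ∑ n ∈ Finset.range (cnt z i),
    h i n (P z i n) * (g (X i n z) - κ i n z)

/-- The conclusion of crux 2 for given data at cell size `r`: `‖S_h‖_{L¹(LG)} ≤ δ`. -/
def KickBoundMeso (σ : ℝ) (a₀ θ₀ : T3 → ℝ) (u₀ : T3 → V3) (N : ℕ) (Φ : Flow σ N) (τ r : ℝ)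
    (g : V3 × V3 × V3 → ℝ) (h : Fin (N + 1) → ℕ → PastMeso N → ℝ) (δ : ℝ) : Prop :=
  ∫⁻ z, ENNReal.ofReal |kickSumMeso σ N Φ τ r g h z| ∂(localGibbsLaw σ a₀ u₀ θ₀ N Φ) ≤ ENNReal.ofReal δ

/-- The body of crux 2 at a FIXED cell sequence `rs`. -/
def KickFairAlong (rs : ℕ → ℝ) : Prop :=
  ∀ (a₀ θ₀ : T3 → ℝ) (u₀ : T3 → V3), Continuous a₀ → Continuous θ₀ → Continuous u₀ →
    (∀ x, 0 < a₀ x) → (∀ x, 0 < θ₀ x) → ∃ σ₀ : ℝ, 0 < σ₀ ∧ ∀ σ : ℝ, 0 < σ → σ < σ₀ →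
    ∀ Φ : (N : ℕ) → Flow σ N, ∀ τ : ℝ, 0 < τ →
    ∀ g : V3 × V3 × V3 → ℝ, Continuous g → (∃ C : ℝ, ∀ p, |g p| ≤ C) →
    ∀ δ : ℝ, 0 < δ → ∃ N₀ : ℕ, ∀ N : ℕ, N₀ ≤ N →
    ∀ h : Fin (N + 1) → ℕ → PastMeso N → ℝ, (∀ i n, Measurable (h i n)) →
    (∀ i n p, |h i n p| ≤ 1) → KickBoundMeso σ a₀ θ₀ u₀ N (Φ N) τ (rs N) g h δ

/-- **Faithful restatement of crux 2 (definitional).** `KickFairRelEquilibriumMeso` is `∃ rs, AdmissibleCells rs ∧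
KickFairAlong rs` — the rev-4 body with `coarseCell r ↦ coarseCell (rs N)` and the window, nothing else (concurring with
rattack-15178 E2.lean `kmeso_iff_window_kickBoundRel4`). [folklore] -/
theorem kickFairRelEquilibriumMeso_iff :
    KickFairRelEquilibriumMeso ↔ ∃ rs : ℕ → ℝ, AdmissibleCells rs ∧ KickFairAlong rs := by
  constructor
  · rintro ⟨rs, h1, h2, h3, h4⟩
    exact ⟨rs, ⟨h1, h2, h3⟩, h4⟩
  · rintro ⟨rs, ⟨h1, h2, h3⟩, h4⟩
    exact ⟨rs, h1, h2, h3, h4⟩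

/-- **The engine's burden at rev 12.** The crux is: FOR EVERY admissible cell sequence, kick-fairness along it gives the
target — the prover may fix an arbitrary admissible `rs` and then knows only `rs → 0` and `ε/rs → 0`
(`tendsto_hsDiameter_div_cells`). [folklore] -/
theorem crux_iff_forall_cells :
    PercolationClosesChaos ↔ ∀ rs : ℕ → ℝ, AdmissibleCells rs → KickFairAlong rs → ContactChaos := by
  rw [crux_iff_kick_imp_target, kickFairRelEquilibriumMeso_iff]
  constructor
  · exact fun h rs hA hK => h ⟨rs, hA, hK⟩
  · rintro h ⟨rs, hA, hK⟩
    exact h rs hA hK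

end Window

/-! ## §2 Vacuity inheritance (F2 at rev 3; F13 at rev 4) and the sign of the sub-cell floor (PROVED)

Rev 3: `crux_of_not_kickIsotropyInfo` (history — `KickIsotropyInfo`, stmt-13478, is HELD under
`Theorems.KickIsotropyInfoNegative.KickIsotropyInfo_false_of_ShieldingBiasPersists`, p84825, and left the route file at
06:46Z). Rev 4: `crux_of_not_kickFairRelEquilibrium` (§1) + the fixed-`r` sub-cell floor of the 14914 record
(Cruxes/KickFairRelEquilibrium/Analysis-r1-k1.md §F3–F4; F13 above). The one piece of that floor which is pure algebra is
proved here so that no later seat hopes for a cancellation "on average over cells": discretise a cell into `n` sub-boxes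
with sub-cell weights `a_i ≥ 0` (the local-equilibrium profile inside the cell; `G | past` is the constant profile). Two
independent `a`-distributed points fall into the same sub-box with probability `Σ a_i² / (Σ a_i)²`, and
`(Σ a_i)² ≤ n Σ a_i²` with equality iff `a` is constant: the LG/G odds ratio of every third-body CO-LOCATION event is
`≥ 1` cell by cell (`= 1 + (r²/6)|∇ log ρ|² + O(r³)` for a smooth density), never below. (The velocity-dependent tilt
`(α_i + α_q)·α_l` of the full formula can have either sign pointwise, which is what an adversarial past-measurable `h`
exploits; the density part alone already gives a one-signed floor.) LANDED verbatim as
`Theorems/PercolationClosesChaos/Negative/SubcellColocationExcess.lean` (p100849 @8a78a4f976a1). -/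

section Colocation

/-- Co-location excess, weak form (Cauchy–Schwarz): `(Σ a)² ≤ n · Σ a²` — two independent draws from ANY sub-cell
profile coincide at least as often as two uniform draws. [folklore] -/
theorem colocation_excess {n : ℕ} (a : Fin n → ℝ) : (∑ i, a i) ^ 2 ≤ n * ∑ i, a i ^ 2 := by
  have := sq_sum_le_card_mul_sum_sq (s := Finset.univ) (f := a)
  simpa using this

/-- Lagrange's identity behind the strict case: `n Σ a² − (Σ a)² = ½ Σᵢ Σⱼ (aᵢ − aⱼ)²`. [folklore] -/
theorem lagrange_identity {n : ℕ} (a : Fin n → ℝ) :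
    (n : ℝ) * ∑ i, a i ^ 2 - (∑ i, a i) ^ 2 = (1 / 2) * ∑ i, ∑ j, (a i - a j) ^ 2 := by
  have h1 : ∑ i, ∑ j, (a i - a j) ^ 2 = ∑ i, ∑ j, (a i ^ 2 + a j ^ 2 - 2 * (a i * a j)) := by
    refine Finset.sum_congr rfl fun i _ => Finset.sum_congr rfl fun j _ => ?_; ring
  rw [h1]
  simp only [Finset.sum_sub_distrib, Finset.sum_add_distrib, Finset.sum_const, Finset.card_univ, Fintype.card_fin,
    nsmul_eq_mul, ← Finset.mul_sum, ← Finset.sum_mul]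
  rw [sq, Finset.sum_mul_sum]
  simp only [← Finset.mul_sum]
  ring

/-- **Co-location excess, strict form**: `(Σ a)² < n · Σ a²` as soon as the sub-cell profile is not constant — the
fixed-`r` floor of F13 is one-signed and vanishes only for a locally homogeneous law. [folklore] -/
theorem colocation_excess_strict {n : ℕ} (a : Fin n → ℝ) {i j : Fin n} (hij : a i ≠ a j) :
    (∑ i, a i) ^ 2 < n * ∑ i, a i ^ 2 := by
  have hL := lagrange_identity a
  have hpos : 0 < ∑ i, ∑ j, (a i - a j) ^ 2 := by
    have hle : (a i - a j) ^ 2 ≤ ∑ j', (a i - a j') ^ 2 :=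
      Finset.single_le_sum (f := fun j' => (a i - a j') ^ 2) (fun _ _ => sq_nonneg _) (Finset.mem_univ j)
    have hle2 : ∑ j', (a i - a j') ^ 2 ≤ ∑ i', ∑ j', (a i' - a j') ^ 2 :=
      Finset.single_le_sum (f := fun i' => ∑ j', (a i' - a j') ^ 2)
        (fun _ _ => Finset.sum_nonneg fun _ _ => sq_nonneg _) (Finset.mem_univ i)
    have hsq : 0 < (a i - a j) ^ 2 := by
      have : a i - a j ≠ 0 := sub_ne_zero.2 hij
      positivity
    linarith
  linarith

end Colocation

/-! ## §3 The spectral input the two-parent engine actually consumes (F3) -/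

/-- The body of `SpectralContractionR` with the contraction constant as a parameter:
`∫ (K f)² dπ ≤ c ∫ f² dπ` for measurable mean-zero `f ∈ L²(π)`, `π ∝ ν M`, `K` the one-collision operator of a
tagged sphere in a Maxwellian bath (verbatim the route's `let`-block). [folklore] -/
def SpectralContractionWith (c : ℝ) : Prop :=
  let M : Literature.MathematicalPhysics.KineticTheory.V3 → ℝ := Literature.Analysis.FluidPDE.globalMaxwellian; let S : MeasureTheory.Measure (Metric.sphere (0 : Literature.MathematicalPhysics.KineticTheory.V3) 1) := Literature.MathematicalPhysics.KineticTheory.sphereMeasure; let ν : Literature.MathematicalPhysics.KineticTheory.V3 → ℝ := fun v => ∫ w, ∫ ω, Literature.MathematicalPhysics.KineticTheory.hardSphereKernel (v, w) ω * M w ∂S; let K : (Literature.MathematicalPhysics.KineticTheory.V3 → ℝ) → Literature.MathematicalPhysics.KineticTheory.V3 → ℝ := fun f v => (ν v)⁻¹ * ∫ w, ∫ ω, Literature.MathematicalPhysics.KineticTheory.hardSphereKernel (v, w) ω * M w * f (Literature.MathematicalPhysics.KineticTheory.collide ω (v, w)).1 ∂S; ∀ f : Literature.MathematicalPhysics.KineticTheory.V3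 → ℝ, Measurable f → MeasureTheory.Integrable (fun v => f v ^ 2 * (ν v * M v)) → ∫ v, f v * (ν v * M v) = 0 → ∫ v, K f v ^ 2 * (ν v * M v) ≤ c * ∫ v, f v ^ 2 * (ν v * M v)

/-- The docked hypothesis, unfolded: `SpectralContractionR ↔ ∃ c < 1/2, SpectralContractionWith c`
(λ₂(K)² < 1/2, i.e. λ₂(K) < 0.7071). [folklore] -/
theorem spectralContractionR_iff :
    SpectralContractionR ↔ ∃ c : ℝ, c < 1 / 2 ∧ SpectralContractionWith c := Iff.rfl

/-- **The hypothesis steps (iii)–(iv) consume.** `λ₂(K) < 1/2`, which for the PSD self-adjoint `K` (‖K‖ = λ₂ on `1^⊥`)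
reads `∃ c < 1/4, ‖K f‖² ≤ c ‖f‖²` on measurable mean-zero `L²(π)`. Numerically TRUE: inf c = λ₂(K)² with
0.219215 ≤ λ₂(K)² (certified rational lower bound, j007068 / local run) and λ₂(K) = 0.46821 (route + this seat),
margin to 1/4: 0.0308. No analytic line on file reaches below 1/4 (swap-symmetrisation gives exactly c = 1/4, excluded).
[folklore] -/
def SpectralContractionQuarter : Prop := ∃ c : ℝ, c < 1 / 4 ∧ SpectralContractionWith c

/-- The consumed hypothesis is STRONGER than the docked one (c < 1/4 ⇒ c < 1/2); the converse fails as a matter of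
real arithmetic on the admissible range of c (any c ∈ [λ₂², 1/2) with c ≥ 1/4 witnesses `R` but not `Quarter`), so a
re-docked crux `KickRepair → SpectralContractionQuarter → ContactChaos` is the honest shape if the percolation census
(step iii) is kept. [folklore] -/
theorem spectralContractionQuarter_imp (h : SpectralContractionQuarter) : SpectralContractionR := by
  obtain ⟨c, hc, hK⟩ := h
  exact ⟨c, by linarith, hK⟩

/-- The off-invariants contraction with constant `c`: the body of `SpectralContractionR` restricted to measurable
`f ∈ L²(π)` orthogonal (in `L²(νM)`) to ALL collision invariants `1, v₁, v₂, v₃, |v|²` (not only to `1`). [folklore] -/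
def SpectralContractionOffInvariantsWith (c : ℝ) : Prop :=
  let M : Literature.MathematicalPhysics.KineticTheory.V3 → ℝ := Literature.Analysis.FluidPDE.globalMaxwellian; let S : MeasureTheory.Measure (Metric.sphere (0 : Literature.MathematicalPhysics.KineticTheory.V3) 1) := Literature.MathematicalPhysics.KineticTheory.sphereMeasure; let ν : Literature.MathematicalPhysics.KineticTheory.V3 → ℝ := fun v => ∫ w, ∫ ω, Literature.MathematicalPhysics.KineticTheory.hardSphereKernel (v, w) ω * M w ∂S; let K : (Literature.MathematicalPhysics.KineticTheory.V3 → ℝ) → Literature.MathematicalPhysics.KineticTheory.V3 → ℝ := fun f v => (ν v)⁻¹ * ∫ w, ∫ ω, Literature.MathematicalPhysics.KineticTheory.hardSphereKernel (v, w) ω * M w * f (Literature.MathematicalPhysics.KineticTheory.collide ω (v, w)).1 ∂S; ∀ f : Literature.MathematicalPhysics.KineticTheory.V3 → ℝ, Measurable f → MeasureTheory.Integrable (fun v => f v ^ 2 * (ν v * M v)) → ∫ v, f v * (ν v * M v) = 0 → (∀ k : Fin 3, ∫ v, f v * v k * (ν v * M v) = 0) → ∫ v, f v * ‖v‖ ^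 2 * (ν v * M v) = 0 → ∫ v, K f v ^ 2 * (ν v * M v) ≤ c * ∫ v, f v ^ 2 * (ν v * M v)

/-- **The spectral input a two-parent engine should consume** (F3 c′): `∃ c < 1/4`, `‖K f‖² ≤ c ‖f‖²` for measurable
`f ∈ L²(π)` orthogonal to the five collision invariants. Numerically inf c = 0.310² = 0.096 (exact-moment Ritz: sup of the
Rayleigh quotient of `K` off the invariants = 0.30999 in ℓ = 0, 0.29921 in ℓ = 1, 0.20448 in ℓ = 2, smaller beyond;
kit j007192) — margin 0.154 to 1/4, versus 0.031 for `SpectralContractionQuarter` and a near-critical energy-like top mode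
(0.46821) for anything stated on mean-zero functions. The invariant sector (transmission exactly ½ + ½ per vertex before
selection) is to be carried, not contracted. [folklore] -/
def SpectralContractionOffInvariants : Prop := ∃ c : ℝ, c < 1 / 4 ∧ SpectralContractionOffInvariantsWith c

/-- Restricting the test class preserves the contraction: `Quarter ⇒ OffInvariants` (the converse is false numerically:
off the invariants c = 0.1 works, on mean-zero functions c ≥ λ₂(K)² ≥ 0.219215 is forced). [folklore] -/
theorem offInvariants_of_quarter (h : SpectralContractionQuarter) : SpectralContractionOffInvariants := by
  obtain ⟨c, hc, hK⟩ := h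
  exact ⟨c, hc, fun f hf hi h0 _ _ => hK f hf hi h0⟩

/-- The corrected Kesten–Stigum-type bookkeeping in one line of arithmetic: with the per-edge covariance factor
`λ` and in-degree 2, the dilution series `Σ (2λ)^M` is subcritical iff `λ < 1/2`; the route's criterion `λ² < 1/2`
admits the whole band `1/2 ≤ λ < √2/2` where the corrected series diverges. Witness λ = 1/2 (keep-or-swap, §4):
route-subcritical (`(1/2)² < 1/2`), corrected-critical (`2·(1/2) = 1`). [folklore] -/
theorem criterion_gap : ((1 : ℝ) / 2) ^ 2 < 1 / 2 ∧ ¬ (2 * ((1 : ℝ) / 2) < 1) := by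
  constructor <;> norm_num

/-! ### §3b Finite shadow of `K = two-output operator` (PROVED): conditionally i.i.d. siblings

Abstract form of F3 over finite types: `S` = values of the pair invariants `s = (v + w, |v − w|)` with weights `p`,
`κ s ·` = law of ONE outgoing velocity given `s` (uniform on the sphere with diameter `[v, w]`, pushed to a finite
alphabet), siblings `V, V′` i.i.d. `κ s` given `s` (for hard spheres the INCOMING `V` is such a sibling too: §5b).
Then the joint law of `(V, V′)` is `sibJoint`, the quadratic form of the one-particle operator `K` in `L²(π)`
(π = marginal) is `sibForm`, and `sibForm = Σ_s p(s) (E[f | s])²` (`sibForm_eq_condSq`): the form of `K` IS the second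
moment of the joint-parent conditional expectation — so `K` is PSD (`sibForm_nonneg`) and the joint-parent
χ²-coefficient is the top eigenvalue `λ₂(K)` itself, not its square. No normalisation of `p`, `κ` is needed. -/

section Siblings

variable {S A : Type*} [Fintype S] [Fintype A]

/-- Joint law of two conditionally i.i.d. siblings: `J(a, a′) = Σ_s p(s) κ(s, a) κ(s, a′)`. [folklore] -/
def sibJoint (p : S → ℚ) (κ : S → A → ℚ) (a a' : A) : ℚ := ∑ s, p s * κ s a * κ s a'

/-- The quadratic form `⟨K f, f⟩_π = Σ_{a,a′} J(a,a′) f(a) f(a′)` of the sibling (= one-particle) operator. [folklore] -/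
def sibForm (p : S → ℚ) (κ : S → A → ℚ) (f : A → ℚ) : ℚ := ∑ a, ∑ a', sibJoint p κ a a' * f a * f a'

/-- Second moment of the joint-parent conditional expectation: `Σ_s p(s) (Σ_a κ(s,a) f(a))²`. [folklore] -/
def condSq (p : S → ℚ) (κ : S → A → ℚ) (f : A → ℚ) : ℚ := ∑ s, p s * (∑ a, κ s a * f a) ^ 2

/-- **`⟨K f, f⟩ = E[(E[f | parents])²]`** for conditionally i.i.d. siblings (finite shadow of `TwoOutputFormEqK`).
[folklore] -/
theorem sibForm_eq_condSq (p : S → ℚ) (κ : S → A → ℚ) (f : A → ℚ) :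
    sibForm p κ f = condSq p κ f := by
  have hL : sibForm p κ f = ∑ s, ∑ a, ∑ a', p s * κ s a * κ s a' * f a * f a' := by
    unfold sibForm sibJoint
    calc ∑ a, ∑ a', (∑ s, p s * κ s a * κ s a') * f a * f a'
        = ∑ a, ∑ a', ∑ s, p s * κ s a * κ s a' * f a * f a' := by
          simp_rw [Finset.sum_mul]
      _ = ∑ a, ∑ s, ∑ a', p s * κ s a * κ s a' * f a * f a' :=
          Finset.sum_congr rfl fun a _ => Finset.sum_comm
      _ = ∑ s, ∑ a, ∑ a', p s * κ s a * κ s a' * f a * f a' := Finset.sum_comm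
  have hR : condSq p κ f = ∑ s, ∑ a, ∑ a', p s * κ s a * κ s a' * f a * f a' := by
    unfold condSq
    refine Finset.sum_congr rfl fun s _ => ?_
    rw [sq, Finset.sum_mul_sum, Finset.mul_sum]
    refine Finset.sum_congr rfl fun a _ => ?_
    rw [Finset.mul_sum]
    refine Finset.sum_congr rfl fun a' _ => ?_
    ring
  rw [hL, hR]

/-- Hence the sibling/one-particle operator is positive semidefinite (the route's "K is PSD: v, v′ conditionally i.i.d.
given the collision invariants", in checkable form). [folklore] -/
theorem sibForm_nonneg {p : S → ℚ} (hp : ∀ s, 0 ≤ p s) (κ : S → A → ℚ) (f : A → ℚ) :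
    0 ≤ sibForm p κ f := by
  rw [sibForm_eq_condSq]
  exact Finset.sum_nonneg fun s _ => mul_nonneg (hp s) (sq_nonneg _)

end Siblings

/-! ## §4 Keep-or-swap in the corrected currency (re-derivation; cf. cdisprove-13480 `not_naivePercolationPrinciple`)

Toy two-parent channel on a finite velocity alphabet with the uniform law: the pair `(v, w)` becomes `(v, w)` or
`(w, v)` with probability 1/2 each ("fair kick", both branches permute the velocities). Its one-particle operator with
an independent uniform partner is `K f = (f + mean f)/2`, so on mean-zero `f`: `‖K f‖² = ¼ ‖f‖²` — the SHAPE of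
`SpectralContractionR` holds with `c = 1/4 < 1/2` (route: "2λ₂² = 1/2 < 1, subcritical") — while `⟨K f, f⟩ = ½ ‖f‖²`,
i.e. `λ₂ = 1/2`, `2λ₂ = 1`: CRITICAL in the corrected currency of F3(b); and indeed nothing is ever forgotten
(`kosRun_perm`: after any kick history the pair is a permutation of the initial pair). -/

section KeepOrSwap

variable {α : Type*}

/-- One keep-or-swap kick on an ordered pair of velocities. [folklore] -/
def kosPair (keep : Bool) (p : α × α) : α × α := if keep then p else p.swap

/-- A run of keep-or-swap kicks driven by a bit string (the "impact vectors"). [folklore] -/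
def kosRun : List Bool → α × α → α × α
  | [], p => p
  | b :: bs, p => kosRun bs (kosPair b p)

/-- ZERO FORGETTING: whatever the (fair, independent) kicks, the pair after the run is the initial pair or its swap —
the initial velocities are transmitted exactly, for ever. [folklore] -/
theorem kosRun_perm (bs : List Bool) (p : α × α) : kosRun bs p = p ∨ kosRun bs p = p.swap := by
  induction bs generalizing p with
  | nil => exact Or.inl rfl
  | cons b bs ih =>
    cases b with
    | true =>
      simpa [kosRun, kosPair] using ih p
    | false =>
      rcases ih p.swap with h | h
      · right; simpa [kosRun, kosPair] using h
      · left; simpa [kosRun, kosPair, Prod.swap_swap] using h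

variable {n : ℕ}

/-- The one-particle keep-or-swap operator with an independent uniform partner on `Fin n`:
`(K f)(v) = ½ f(v) + ½ · mean(f)`. [folklore] -/
def kosK (f : Fin n → ℚ) (v : Fin n) : ℚ := (f v + (∑ w, f w) / n) / 2

/-- On mean-zero functions `K = ½ · id`. [folklore] -/
theorem kosK_of_meanZero {f : Fin n → ℚ} (hf : ∑ w, f w = 0) (v : Fin n) : kosK f v = f v / 2 := by
  simp [kosK, hf]

/-- The ROUTE's currency: `‖K f‖² = ¼ ‖f‖²` on mean-zero `f` — contraction constant `c = 1/4 < 1/2`, so the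
keep-or-swap channel satisfies the shape of `SpectralContractionR` ("2λ₂² = 1/2 < 1: subcritical"). [folklore] -/
theorem kosK_sq {f : Fin n → ℚ} (hf : ∑ w, f w = 0) :
    ∑ v, kosK f v ^ 2 = (1 / 4) * ∑ v, f v ^ 2 := by
  simp_rw [kosK_of_meanZero hf, Finset.mul_sum]
  refine Finset.sum_congr rfl fun v _ => ?_
  ring

/-- The CORRECTED currency: `⟨K f, f⟩ = ½ ‖f‖²`, i.e. `λ₂ = 1/2` and `2 λ₂ = 1` — critical, matching the zero
forgetting of `kosRun_perm`. [folklore] -/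
theorem kosK_form {f : Fin n → ℚ} (hf : ∑ w, f w = 0) :
    ∑ v, kosK f v * f v = (1 / 2) * ∑ v, f v ^ 2 := by
  simp_rw [kosK_of_meanZero hf, Finset.mul_sum]
  refine Finset.sum_congr rfl fun v _ => ?_
  ring

end KeepOrSwap

/-! ## §5 Typed claims for the record (statements only; proofs are measure theory on the sphere, not attempted)

`TwoOutputFormEqK`: the quadratic form of `K` is the second moment of the JOINT-parent conditional expectation
(F3; proof sketch: flux-distributed ω ⇒ reflected relative direction uniform on S², independent of (v+w, |v−w|);
numerically certified by j007068 reproducing 3/7, 7/15, 15/79, 0.4682). A prover of the re-docked engine needs it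
(it is also the PSD-ness of `K` the route quotes); an ideator may import the statement. -/

/-- **Two-output form = form of K** (F3): for bounded measurable `f`,
`∫ f(v) (K f)(v) ν(v) M(v) dv = ∫∫ M(v) M(w) (π|v−w|)⁻¹ (∫ B f(v′) dω) (∫ B f(v″) dω′) dw dv`
— the right-hand side is `Z · E_Λ[(E[f(V′) | V, W])²]`, `Λ ∝ |v−w| M M`, since given `(v, w)` the impact vector has
density `B/(π|v−w|)` (`∫_{S²} ((v−w)·ω)₊ dω = π |v−w|`). Equivalently: the input-restricted joint-parent
χ²-contraction coefficient of the collision vertex equals `λ₂(K)`. Statement only. [folklore] -/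
def TwoOutputFormEqK : Prop :=
  let M : Literature.MathematicalPhysics.KineticTheory.V3 → ℝ := Literature.Analysis.FluidPDE.globalMaxwellian
  let S : MeasureTheory.Measure (Metric.sphere (0 : Literature.MathematicalPhysics.KineticTheory.V3) 1) :=
    Literature.MathematicalPhysics.KineticTheory.sphereMeasure
  let B := Literature.MathematicalPhysics.KineticTheory.hardSphereKernel
      (E := Literature.MathematicalPhysics.KineticTheory.V3)
  let ν : Literature.MathematicalPhysics.KineticTheory.V3 → ℝ := fun v => ∫ w, ∫ ω, B (v, w) ω * M w ∂S
  let K : (Literature.MathematicalPhysics.KineticTheory.V3 → ℝ) → Literature.MathematicalPhysics.KineticTheory.V3 → ℝ :=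
    fun f v => (ν v)⁻¹ * ∫ w, ∫ ω, B (v, w) ω * M w *
      f (Literature.MathematicalPhysics.KineticTheory.collide ω (v, w)).1 ∂S
  ∀ f : Literature.MathematicalPhysics.KineticTheory.V3 → ℝ, Measurable f → (∃ C, ∀ v, |f v| ≤ C) →
    ∫ v, f v * K f v * (ν v * M v) =
      ∫ v, ∫ w, M v * M w * (Real.pi * ‖v - w‖)⁻¹ *
        ((∫ ω, B (v, w) ω * f (Literature.MathematicalPhysics.KineticTheory.collide ω (v, w)).1 ∂S) *
         (∫ ω, B (v, w) ω * f (Literature.MathematicalPhysics.KineticTheory.collide ω (v, w)).1 ∂S))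

/-! ### §5b Kinematic identities behind F3 (PROVED): the outgoing velocity lives on the sphere with diameter `[v, w]`

`v′ = (v+w)/2 + m_ω`, `m_ω := (v−w)/2 − ⟪v−w, ω⟫ ω`, `‖m_ω‖ = ‖v−w‖/2`, `⟪v−w, m_ω⟫ = ‖v−w‖²/2 − ⟪v−w, ω⟫²`
(so the cosine between the incoming relative direction and `n := m_ω/‖m_ω‖` is `1 − 2cos²θ`, `cos θ = ⟪q̂, ω⟫`; under
the flux law `cos²θ` is uniform, hence `n` is uniform on S² — the single measure-level step of F3, typed above as
`TwoOutputFormEqK`), and the energy bookkeeping `‖v′‖² = ‖v+w‖²/4 + ‖v−w‖²/4 + ⟪v+w, m_ω⟫`: the child carries the parents'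
mean energy plus a zero-mean increment — transmission exactly ½ + ½ in the energy sector (F3 d, c′). -/

section Kinematics

open Literature.MathematicalPhysics.KineticTheory
open scoped InnerProductSpace RealInnerProductSpace

/-- CM decomposition of the outgoing velocity of the tagged sphere: `v′ = (v + w)/2 + ((v − w)/2 − ⟪v − w, ω⟫ ω)`.
[folklore] -/
theorem collide_fst_eq_cm (ω : Metric.sphere (0 : V3) 1) (v w : V3) :
    (collide ω (v, w)).1 =
      (1 / 2 : ℝ) • (v + w) + ((1 / 2 : ℝ) • (v - w) - ⟪v - w, (ω : V3)⟫_ℝ • (ω : V3)) := by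
  simp only [collide]
  module

/-- The reflected half relative velocity has norm `‖q‖/2`: the outgoing velocity lies on the sphere with diameter
`[v, w]` whatever the impact vector. [folklore] -/
theorem norm_half_sub_reflect (ω : Metric.sphere (0 : V3) 1) (q : V3) :
    ‖(1 / 2 : ℝ) • q - ⟪q, (ω : V3)⟫_ℝ • (ω : V3)‖ = ‖q‖ / 2 := by
  have hω : ‖(ω : V3)‖ = 1 := norm_eq_of_mem_sphere ω
  have h2 : ‖(1 / 2 : ℝ) • q - ⟪q, (ω : V3)⟫_ℝ • (ω : V3)‖ ^ 2 = (‖q‖ / 2) ^ 2 := by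
    rw [norm_sub_sq_real, norm_smul, norm_smul, real_inner_smul_left, real_inner_smul_right, hω,
      Real.norm_eq_abs, Real.norm_eq_abs, mul_one, mul_pow, sq_abs, sq_abs]
    ring
  have ha : 0 ≤ ‖(1 / 2 : ℝ) • q - ⟪q, (ω : V3)⟫_ℝ • (ω : V3)‖ := norm_nonneg _
  have hb : 0 ≤ ‖q‖ / 2 := by positivity
  nlinarith [h2, ha, hb, sq_nonneg (‖(1 / 2 : ℝ) • q - ⟪q, (ω : V3)⟫_ℝ • (ω : V3)‖ - ‖q‖ / 2)]

/-- Cosine of the outgoing relative direction against the incoming one: `⟪q, q/2 − ⟪q, ω⟫ ω⟫ = ‖q‖²/2 − ⟪q, ω⟫²`,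
i.e. `⟪q̂, n⟫ = 1 − 2 ⟪q̂, ω⟫²` — with `⟪q̂, ω⟫²` uniform on `[0,1]` under the flux law `((q·ω))₊ dω`, `⟪q̂, n⟫` is
uniform on `[−1, 1]` (Archimedes: `n` uniform on S²). [folklore] -/
theorem inner_half_sub_reflect (ω : Metric.sphere (0 : V3) 1) (q : V3) :
    ⟪q, (1 / 2 : ℝ) • q - ⟪q, (ω : V3)⟫_ℝ • (ω : V3)⟫_ℝ = ‖q‖ ^ 2 / 2 - ⟪q, (ω : V3)⟫_ℝ ^ 2 := by
  rw [inner_sub_right, real_inner_smul_right, real_inner_smul_right, real_inner_self_eq_norm_sq]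
  ring

/-- Energy bookkeeping of one collision: `‖v′‖² = ‖v + w‖²/4 + ‖v − w‖²/4 + ⟪v + w, m_ω⟫` — the parents' MEAN energy
`(‖v‖² + ‖w‖²)/2 = (‖v+w‖² + ‖v−w‖²)/4` plus an increment linear in the (uniform, mean-zero) direction `n`: the energy
sector is transmitted with weight exactly `½` from each parent (critical `2 · ½ = 1` before flux selection; F3 d).
[folklore] -/
theorem norm_sq_collide_fst (ω : Metric.sphere (0 : V3) 1) (v w : V3) :
    ‖(collide ω (v, w)).1‖ ^ 2 =
      ‖v + w‖ ^ 2 / 4 + ‖v - w‖ ^ 2 / 4 +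
        ⟪v + w, (1 / 2 : ℝ) • (v - w) - ⟪v - w, (ω : V3)⟫_ℝ • (ω : V3)⟫_ℝ := by
  rw [collide_fst_eq_cm, norm_add_sq_real, norm_smul, Real.norm_eq_abs, mul_pow, sq_abs,
    norm_half_sub_reflect, real_inner_smul_left]
  ring

end Kinematics

/-! ## §6 The operator the crux does not mention: the CROSS (exchange) operator `K̃`

A collision vertex has two in-edges AND two out-edges. Information entering along the tagged
sphere's edge leaves along BOTH outgoing edges: to the tagged sphere's own future (operator
`K f (v) = E[f(v′) | v]`, the route's `K`) and to the PARTNER's future (operator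
`K̃ f (v) = E[f(w′) | v]`). A path census over the collision DAG therefore weighs each step by `K` or by
`K̃` according to whether the lineage stays on the same sphere or crosses to the partner, and the
sign-blind dilution parameter per generation is `ρ(K) + ρ(K̃)` (top mean-zero eigenvalue / norm of
each), NOT a function of `K` alone. Finite shadow (keep with probability `p`, swap with probability
`1 − p`, independent uniform partner on `Fin n`): `K = p · id`, `K̃ = (1 − p) · id` on mean-zero
functions, so `‖K f‖² = p² ‖f‖²` — the SHAPE of `SpectralContractionR` with ANY constant `c = p² > 0`
(and even the corrected single-sphere criterion `2ρ(K) = 2p < 1` of F3(b) for `p < 1/2`) — while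
`ρ(K) + ρ(K̃) = 1`: critical, and indeed nothing is ever forgotten (`kosRun_perm`, §4, any coin bias).
For hard spheres `K̃ = K` (the partner's outgoing velocity is the ANTIPODE of the tagged one on the
collision sphere, `collide_snd_eq_cm_sub`, and the outgoing direction is uniform under the flux law,
§5b), typed below as `CrossOpEqOp`; granted that, the parameter is `2λ₂(K) = 0.936` as in F3. -/

section KeepSwapFamily

variable {n : ℕ}

/-- keep(`p`)/swap(`1 − p`) channel, SAME-sphere operator with an independent uniform partner:
`(K_p f)(v) = p f(v) + (1 − p) · mean f`. [folklore] -/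
def kspK (p : ℚ) (f : Fin n → ℚ) (v : Fin n) : ℚ := p * f v + (1 - p) * ((∑ w, f w) / n)

/-- keep(`p`)/swap(`1 − p`) channel, CROSS operator `(K̃_p f)(v) = E[f(w′) | v]`: the partner keeps
its own (independent, uniform) velocity with probability `p` and receives `v` with probability
`1 − p`: `(K̃_p f)(v) = p · mean f + (1 − p) f(v)`. [folklore] -/
def kspKx (p : ℚ) (f : Fin n → ℚ) (v : Fin n) : ℚ := p * ((∑ w, f w) / n) + (1 - p) * f v

/-- On mean-zero functions `K_p = p · id`. [folklore] -/
theorem kspK_of_meanZero {p : ℚ} {f : Fin n → ℚ} (hf : ∑ w, f w = 0) (v : Fin n) :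
    kspK p f v = p * f v := by
  simp [kspK, hf]

/-- On mean-zero functions `K̃_p = (1 − p) · id`. [folklore] -/
theorem kspKx_of_meanZero {p : ℚ} {f : Fin n → ℚ} (hf : ∑ w, f w = 0) (v : Fin n) :
    kspKx p f v = (1 - p) * f v := by
  simp [kspKx, hf]

/-- The route's currency for the family: `‖K_p f‖² = p² ‖f‖²` on mean-zero `f` — the shape of
`SpectralContractionR` holds with the constant `c = p²`, as small as desired. [folklore] -/
theorem kspK_sq {p : ℚ} {f : Fin n → ℚ} (hf : ∑ w, f w = 0) :
    ∑ v, kspK p f v ^ 2 = p ^ 2 * ∑ v, f v ^ 2 := by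
  simp_rw [kspK_of_meanZero hf, Finset.mul_sum]
  refine Finset.sum_congr rfl fun v _ => ?_
  ring

/-- F3(b)'s single-sphere currency for the family: `⟨K_p f, f⟩ = p ‖f‖²`, i.e. `ρ(K_p) = p`,
`2ρ(K_p) = 2p < 1` for `p < 1/2` — "subcritical" by any criterion that looks at `K` alone. [folklore] -/
theorem kspK_form {p : ℚ} {f : Fin n → ℚ} (hf : ∑ w, f w = 0) :
    ∑ v, kspK p f v * f v = p * ∑ v, f v ^ 2 := by
  simp_rw [kspK_of_meanZero hf, Finset.mul_sum]
  refine Finset.sum_congr rfl fun v _ => ?_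
  ring

/-- The cross operator carries the rest: `⟨K̃_p f, f⟩ = (1 − p) ‖f‖²`, `ρ(K̃_p) = 1 − p`. [folklore] -/
theorem kspKx_form {p : ℚ} {f : Fin n → ℚ} (hf : ∑ w, f w = 0) :
    ∑ v, kspKx p f v * f v = (1 - p) * ∑ v, f v ^ 2 := by
  simp_rw [kspKx_of_meanZero hf, Finset.mul_sum]
  refine Finset.sum_congr rfl fun v _ => ?_
  ring

/-- **The honest per-generation parameter is `ρ(K) + ρ(K̃)`, here `p + (1 − p) = 1`: critical for
every `p`** — consistent with ZERO forgetting (`kosRun_perm`: after any kick history the velocity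
pair is a permutation of the initial pair, whatever the coin bias). [folklore] -/
theorem kspK_add_kspKx_form {p : ℚ} {f : Fin n → ℚ} (hf : ∑ w, f w = 0) :
    ∑ v, kspK p f v * f v + ∑ v, kspKx p f v * f v = ∑ v, f v ^ 2 := by
  rw [kspK_form hf, kspKx_form hf]
  ring

/-- Joint-parent conditional expectation of the family: `E[f(V′) | V = v, W = w] = p f(v) + (1 − p) f(w)`.
[folklore] -/
def kspJoint (p : ℚ) (f : Fin n → ℚ) (v w : Fin n) : ℚ := p * f v + (1 - p) * f w

/-- Second moment of the joint-parent conditional expectation under independent uniform parents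
(unnormalised sums): `Σ_v Σ_w (p f(v) + (1 − p) f(w))² = (p² + (1 − p)²) · n · Σ f²` for mean-zero `f`,
i.e. the joint-parent χ²-ratio of the family is `p² + (1 − p)²`. [folklore] -/
theorem kspJoint_sq {p : ℚ} {f : Fin n → ℚ} (hf : ∑ w, f w = 0) :
    ∑ v, ∑ w, kspJoint p f v w ^ 2 = (p ^ 2 + (1 - p) ^ 2) * ((n : ℚ) * ∑ v, f v ^ 2) := by
  have hrow : ∀ v, ∑ w, kspJoint p f v w ^ 2 =
      (n : ℚ) * (p ^ 2 * f v ^ 2) + (1 - p) ^ 2 * ∑ w, f w ^ 2 := by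
    intro v
    have h1 : ∀ w, kspJoint p f v w ^ 2 =
        p ^ 2 * f v ^ 2 + ((1 - p) ^ 2 * f w ^ 2 + (2 * p * (1 - p) * f v) * f w) := by
      intro w; unfold kspJoint; ring
    rw [Finset.sum_congr rfl fun w _ => h1 w, Finset.sum_add_distrib, Finset.sum_add_distrib,
      Finset.sum_const, Finset.card_univ, Fintype.card_fin, nsmul_eq_mul, ← Finset.mul_sum,
      ← Finset.mul_sum, hf, mul_zero, add_zero]
  rw [Finset.sum_congr rfl fun v _ => hrow v, Finset.sum_add_distrib, ← Finset.mul_sum,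
    ← Finset.mul_sum, Finset.sum_const, Finset.card_univ, Fintype.card_fin, nsmul_eq_mul]
  ring

/-- The joint-parent ratio of the family is `≥ 1/2` for every `p` — at or above the binary-branching
threshold — matching its zero forgetting; the single-sphere constants `p²`, `p` say nothing. [folklore] -/
theorem half_le_jointCoeff (p : ℚ) : 1 / 2 ≤ p ^ 2 + (1 - p) ^ 2 := by
  nlinarith [sq_nonneg (2 * p - 1)]

/-- Equality `p² + (1 − p)² = 1/2` exactly at the fair coin `p = 1/2` (§4's keep-or-swap). [folklore] -/
theorem jointCoeff_eq_half_iff (p : ℚ) : p ^ 2 + (1 - p) ^ 2 = 1 / 2 ↔ p = 1 / 2 := by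
  constructor
  · intro h
    have h2 : (2 * p - 1) ^ 2 = 0 := by nlinarith [h]
    have h3 : 2 * p - 1 = 0 := pow_eq_zero_iff (n := 2) (by norm_num) |>.1 h2
    linarith
  · rintro rfl; norm_num

/-- **No hypothesis on the single-sphere operator `K` can drive a dilution argument**: for every
`c > 0` the family contains a channel whose `K` satisfies the shape of `SpectralContractionR` with
constant `p² < c` and the corrected single-sphere criterion `2p < 1`, whose cross operator has
`ρ(K̃) = 1 − p > 1/2`, whose joint-parent ratio is `≥ 1/2`, and which forgets nothing. [folklore] -/
theorem exists_ksp_below (c : ℚ) (hc : 0 < c) :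
    ∃ p : ℚ, 0 < p ∧ 2 * p < 1 ∧ p ^ 2 < c ∧ 1 / 2 < 1 - p ∧ 1 / 2 ≤ p ^ 2 + (1 - p) ^ 2 := by
  refine ⟨min (1 / 4) c, lt_min (by norm_num) hc, ?_, ?_, ?_, half_le_jointCoeff _⟩
  · have := min_le_left (1 / 4 : ℚ) c; linarith
  · have h1 := min_le_left (1 / 4 : ℚ) c
    have h2 := min_le_right (1 / 4 : ℚ) c
    have h0 : 0 < min (1 / 4 : ℚ) c := lt_min (by norm_num) hc
    calc min (1 / 4 : ℚ) c ^ 2 = min (1 / 4) c * min (1 / 4) c := sq _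
      _ ≤ (1 / 4) * c := mul_le_mul h1 h2 h0.le (by norm_num)
      _ < c := by linarith
  · have := min_le_left (1 / 4 : ℚ) c; linarith

end KeepSwapFamily

/-! ### §6b Hard spheres: the partner's output is the antipode of the tagged output (PROVED), so
`K̃ = K` once the outgoing direction is uniform (typed claim `CrossOpEqOp`) -/

section Cross

open Literature.MathematicalPhysics.KineticTheory
open scoped InnerProductSpace RealInnerProductSpace

/-- CM decomposition of the PARTNER's outgoing velocity: `w′ = (v + w)/2 − ((v − w)/2 − ⟪v − w, ω⟫ ω)` —
the antipode of `v′ = (v + w)/2 + (…)` (§5b `collide_fst_eq_cm`) on the sphere with diameter `[v, w]`.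
[folklore] -/
theorem collide_snd_eq_cm_sub (ω : Metric.sphere (0 : V3) 1) (v w : V3) :
    (collide ω (v, w)).2 =
      (1 / 2 : ℝ) • (v + w) - ((1 / 2 : ℝ) • (v - w) - ⟪v - w, (ω : V3)⟫_ℝ • (ω : V3)) := by
  simp only [collide]
  module

/-- The two outputs are symmetric about the centre of mass: `v′ + w′ = v + w` and
`v′ − (v+w)/2 = −(w′ − (v+w)/2)`. [folklore] -/
theorem collide_fst_sub_cm_eq_neg (ω : Metric.sphere (0 : V3) 1) (v w : V3) :
    (collide ω (v, w)).1 - (1 / 2 : ℝ) • (v + w) = -((collide ω (v, w)).2 - (1 / 2 : ℝ) • (v + w)) := by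
  simp only [collide]
  module

/-- Parent-exchange symmetry of the collision rule: the tagged output with the parents exchanged is
the partner's output, `(collide ω (w, v)).1 = (collide ω (v, w)).2`. [folklore] -/
theorem collide_fst_swap (ω : Metric.sphere (0 : V3) 1) (v w : V3) :
    (collide ω (w, v)).1 = (collide ω (v, w)).2 := by
  simp only [collide]
  rw [← neg_sub v w, inner_neg_left, neg_smul, sub_neg_eq_add]

/-- **`K̃ = K` for hard spheres** (typed claim; PRINTED — Cercignani, *The Boltzmann Equation and Its
Applications* (1988), Ch. IV §5, Eqs. (5.5)–(5.7): rotating the impact vector through `π/2` in the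
collision plane, `θ → π/2 − θ`, `ε → ε ± π`, unit Jacobian, maps `ξ′_*` to `ξ′`, so the two gain terms
of the linearised operator merge into `B̄(θ) = B(θ) + B(π/2 − θ)`; rigid spheres have
`B ∝ V sin θ cos θ = B(π/2 − θ)`, hence the cross gain term EQUALS the direct one): for bounded
measurable `f` and every `v`,
`∫∫ ((v−w)·ω)₊ M(w) f(w′) dω dw = ∫∫ ((v−w)·ω)₊ M(w) f(v′) dω dw`. Equivalently: `w′` is the antipode
of `v′` on the collision sphere (`collide_fst_sub_cm_eq_neg`) and the outgoing direction is uniform on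
`S²` under the flux measure (§5b `inner_half_sub_reflect` + Archimedes; one-variable form PROVED in
§6c, `integral_comp_outgoingCos_d3`), a law invariant under the antipodal map. A `d = 3` ACCIDENT:
for hard disks the flux law `cos θ dθ` is not symmetric under `θ → π/2 − θ` and the claim is false
(§6c `flux_moment_cos_two_mul_d2`: mean outgoing cosine `∓1/3` for the two outputs). Tool in tree
for a prover of the `d = 3` statement: the Carleman change of variables
`Literature.MathematicalPhysics.KineticTheory.lintegral_gain_eq_carleman` (TaggedSphereCarleman), or
the explicit measure-preserving involution `x ↦ (−x₁x₃/ρ, −x₂x₃/ρ, ρ)`, `ρ = √(x₁²+x₂²)`, of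
`{x₃ > 0}` for the weight `x₃ e^{−|x|²/2} dx` (Jacobian `x₃/ρ`); or — the most Mathlib-friendly
route — the THALES–ARCHIMEDES PUSH-FORWARD `∫_{S²} (q·ν)₊ F((q·ν)ν) dσ(ν) = (‖q‖/4) ∫_{S²} F(q/2 + (‖q‖/2)η) dσ(η)`
(the tagged output `v − (q·ν)ν` and the partner's `w + (q·ν)ν` then differ by the antipodal map
`η ↦ −η` of the collision sphere, under which `σ` is invariant: `lintegral_sphere_neg`), itself the
polar-coordinate shadow (`measurePreserving_homeomorphUnitSphereProd`) of the change of variables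
(`lintegral_image_eq_lintegral_abs_det_fderiv_mul`) for the squaring-type map
`Φ(x) = 2⟪q̂, x⟫x − ‖x‖² q̂` of the open half-space `{⟪q̂, x⟫ > 0}` onto `ℝ³` minus a ray: `‖Φ(x)‖ = ‖x‖²`,
`Φ(x)/‖Φ(x)‖ = 2⟪q̂, x̂⟫x̂ − q̂` (inscribed-angle doubling), `DΦ(x)h = 2⟪q̂, h⟫x + 2⟪q̂, x⟫h − 2⟪x, h⟫q̂`,
`det DΦ(x) = 8⟪q̂, x⟫‖x‖²` (matrix-determinant lemma for the rank-two update, or `Matrix.det_fin_three`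
with `q̂ = e₃`). Consequence: the cross operator of
the collision vertex equals the route's `K`, so the sign-blind dilution parameter of the engine is
`ρ(K) + ρ(K̃) = 2λ₂(K) = 0.936` (F3), and NOT anything `SpectralContractionR` alone controls (§6).
Statement only. [cite: Cercignani1988, Ch. IV §5 (5.5)–(5.7)] -/
def CrossOpEqOp : Prop :=
  let M : V3 → ℝ := Literature.Analysis.FluidPDE.globalMaxwellian
  let S : MeasureTheory.Measure (Metric.sphere (0 : V3) 1) := sphereMeasure
  let B := hardSphereKernel (E := V3)
  ∀ f : V3 → ℝ, Measurable f → (∃ C, ∀ v, |f v| ≤ C) → ∀ v : V3,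
    ∫ w, ∫ ω, B (v, w) ω * M w * f (collide ω (v, w)).2 ∂S =
      ∫ w, ∫ ω, B (v, w) ω * M w * f (collide ω (v, w)).1 ∂S

end Cross

/-! ### §6c One-variable shadows of the outgoing-direction law (PROVED; F11): uniform in `d = 3`, not in `d = 2`

With `θ` the angle between the impact vector and the incoming relative velocity, the outgoing cosine is
`t = 1 − 2cos²θ = −cos 2θ` (§5b `inner_half_sub_reflect`). The `d = 3` flux law of `θ` is `∝ sin 2θ dθ` on
`(0, π/2)`; the `d = 2` flux law is `cos θ dθ` on `(−π/2, π/2)`. The lemmas below are also LANDED verbatim as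
`Theorems/PercolationClosesChaos/Negative/OutgoingDirectionShadow.lean` (importable). -/

section OutgoingDirection

open Real intervalIntegral Set

/-- **Archimedes in one variable (`d = 3`).** Under the flux law `∝ sin 2θ dθ` on `(0, π/2)` the outgoing cosine
`t = −cos 2θ` is uniform on `[−1, 1]`: `∫₀^{π/2} g(−cos 2θ) · 2 sin 2θ dθ = ∫_{−1}^{1} g(t) dt` for continuous `g`.
[folklore] -/
theorem integral_comp_outgoingCos_d3 (g : ℝ → ℝ) (hg : Continuous g) :
    ∫ θ in (0 : ℝ)..(π / 2), g (-cos (2 * θ)) * (2 * sin (2 * θ)) = ∫ t in (-1 : ℝ)..1, g t := by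
  have hderiv : ∀ x ∈ uIcc (0 : ℝ) (π / 2),
      HasDerivAt (fun θ : ℝ => -cos (2 * θ)) (2 * sin (2 * x)) x := by
    intro x _
    have h1 : HasDerivAt (fun θ : ℝ => 2 * θ) 2 x := by
      simpa using (hasDerivAt_id x).const_mul (2 : ℝ)
    have h2 : HasDerivAt (fun θ : ℝ => cos (2 * θ)) (-sin (2 * x) * 2) x :=
      (hasDerivAt_cos (2 * x)).comp x h1
    exact h2.neg.congr_deriv (by ring)
  have hcont : ContinuousOn (fun x : ℝ => 2 * sin (2 * x)) (uIcc (0 : ℝ) (π / 2)) :=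
    (continuous_const.mul (continuous_sin.comp (continuous_const.mul continuous_id))).continuousOn
  have h := integral_comp_mul_deriv hderiv hcont hg
  have h0 : -cos (2 * (0 : ℝ)) = -1 := by simp
  have h1 : -cos (2 * (π / 2)) = 1 := by
    rw [show 2 * (π / 2) = π by ring, cos_pi]; norm_num
  rw [h0, h1] at h
  simpa [Function.comp] using h

/-- Total `d = 3` flux mass in this normalisation: `∫₀^{π/2} 2 sin 2θ dθ = 2`. [folklore] -/
theorem flux_mass_d3 : ∫ θ in (0 : ℝ)..(π / 2), (2 * sin (2 * θ)) = 2 := by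
  have h := integral_comp_outgoingCos_d3 (fun _ => (1 : ℝ)) continuous_const
  simp only [one_mul] at h
  rw [h]
  simp
  norm_num

/-- **Isotropy, first moment (`d = 3`)**: the mean outgoing cosine vanishes, `∫₀^{π/2} (−cos 2θ) 2 sin 2θ dθ = 0` —
the symmetric law `CrossOpEqOp` needs. [folklore] -/
theorem flux_moment_cos_two_mul_d3 :
    ∫ θ in (0 : ℝ)..(π / 2), (-cos (2 * θ)) * (2 * sin (2 * θ)) = 0 := by
  have h := integral_comp_outgoingCos_d3 (fun t => t) continuous_id
  rw [h, integral_id]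
  norm_num

/-- Total `d = 2` flux mass: `∫_{−π/2}^{π/2} cos θ dθ = 2`. [folklore] -/
theorem flux_mass_d2 : ∫ θ in (-(π / 2))..(π / 2), cos θ = 2 := by
  rw [integral_cos, sin_pi_div_two, sin_neg, sin_pi_div_two]
  norm_num

/-- **Anisotropy of hard-DISK scattering (`d = 2`)** — refutation of the dimension-free strengthening of
`CrossOpEqOp`/`TwoOutputFormEqK`: `∫_{−π/2}^{π/2} cos 2θ cos θ dθ = 2/3`, so the flux mean of `cos 2θ` is `1/3 ≠ 0`:
the outgoing cosine `t = −cos 2θ` has mean `−1/3`, the partner's (antipodal) direction `+1/3`, and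
`E[f(w′) | v] ≠ E[f(v′) | v]` already for `f` linear in the relative direction. [folklore] -/
theorem flux_moment_cos_two_mul_d2 :
    ∫ θ in (-(π / 2))..(π / 2), cos (2 * θ) * cos θ = 2 / 3 := by
  have hderiv : ∀ x ∈ uIcc (-(π / 2)) (π / 2),
      HasDerivAt (fun θ : ℝ => sin θ / 2 + sin (3 * θ) / 6) (cos (2 * x) * cos x) x := by
    intro x _
    have h1 : HasDerivAt (fun θ : ℝ => sin θ / 2) (cos x / 2) x := (hasDerivAt_sin x).div_const 2
    have h3x : HasDerivAt (fun θ : ℝ => 3 * θ) 3 x := by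
      simpa using (hasDerivAt_id x).const_mul (3 : ℝ)
    have h2 : HasDerivAt (fun θ : ℝ => sin (3 * θ) / 6) (cos (3 * x) * 3 / 6) x :=
      ((hasDerivAt_sin (3 * x)).comp x h3x).div_const 6
    refine (h1.add h2).congr_deriv ?_
    rw [cos_three_mul, cos_two_mul]
    ring
  have hint : IntervalIntegrable (fun x : ℝ => cos (2 * x) * cos x) MeasureTheory.volume (-(π / 2)) (π / 2) :=
    ((continuous_cos.comp (continuous_const.mul continuous_id)).mul continuous_cos).intervalIntegrable _ _
  rw [integral_eq_sub_of_hasDerivAt hderiv hint]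
  have hs1 : sin (π / 2) = 1 := sin_pi_div_two
  have hs3 : sin (3 * (π / 2)) = -1 := by
    rw [show 3 * (π / 2) = π / 2 + π by ring, sin_add_pi, sin_pi_div_two]
  have hs1' : sin (-(π / 2)) = -1 := by rw [sin_neg, sin_pi_div_two]
  have hs3' : sin (3 * -(π / 2)) = 1 := by
    rw [show 3 * -(π / 2) = -(3 * (π / 2)) by ring, sin_neg, hs3]; norm_num
  simp only [hs1, hs3, hs1', hs3']
  norm_num

/-- Side by side: the normalised flux mean of `cos 2θ` is `0` for spheres and `1/3` for disks. [folklore] -/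
theorem flux_mean_cos_two_mul_d3_ne_d2 :
    (∫ θ in (0 : ℝ)..(π / 2), (-cos (2 * θ)) * (2 * sin (2 * θ))) / (∫ θ in (0 : ℝ)..(π / 2), (2 * sin (2 * θ)))
      ≠ -((∫ θ in (-(π / 2))..(π / 2), cos (2 * θ) * cos θ) / (∫ θ in (-(π / 2))..(π / 2), cos θ)) := by
  rw [flux_moment_cos_two_mul_d3, flux_mass_d3, flux_moment_cos_two_mul_d2, flux_mass_d2]
  norm_num

end OutgoingDirection

/-! ## §7 Convention audit of the target as a theorem: the marks tested by `ContactChaos` lie in the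
support hemisphere of its reference kernel

`ContactChaos` tests the empirical collision marks `(ω, v, w) = (ε⁻¹ sepVec x_i x_j, pv.1, pv.2)`,
`pv = reflectVel (sepVec x_i x_j) (v_i(s), v_j(s))`, against the reference flux `hardSphereKernel (w, v) ω =
((w − v)·ω)₊`. A sign/orientation slip here (post- instead of pre-collisional velocities, or `ω ↦ −ω`)
would make the target false in equilibrium for every `Ψ` odd under `ω ↦ −ω` — a cheap-kill door. It is
CLOSED: trajectories are right-continuous (`IsHardSphereTrajectory.binary`), so `(v_i(s), v_j(s))` is
post-collisional, `reflectVel` recovers the incoming pair, and incoming means `⟪x_i − x_j, v_i⁻ − v_j⁻⟫ < 0`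
(`IsHardSphereTrajectory.inner_sepVec_preVel_neg`), i.e. `(w − v)·ω > 0` with the target's `ω`. -/

section Convention

open Literature.Analysis.FluidPDE
open scoped InnerProductSpace RealInnerProductSpace

variable {d : Type*} [Fintype d] {X : Type*} [TopologicalSpace X] {N : ℕ}
  {G : Geometry d X} {ε : ℝ} {γ : ℝ → Config N d X}

/-- **The target's marks are incoming for its own kernel.** Along a hard-sphere trajectory, at every
ordered contact pair `(i, j)` the mark `(ω, v, w)` that `ContactChaos` feeds to `Ψ` — `ω = ε⁻¹ (x_i − x_j)`,
`(v, w) = reflectVel (x_i − x_j) (v_i, v_j)` — satisfies `0 < ⟪w − v, ω⟫`, so the reference weight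
`hardSphereKernel (w, v) ω̂ = ((w − v)·ω̂)₊` is positive there: no orientation mismatch between the
empirical and the reference side of the cross-ratio defect. [folklore] -/
theorem contactMark_inner_pos (hε : 0 < ε) (h : IsHardSphereTrajectory G ε N γ) {t : ℝ} {i j : Fin N}
    (hp : (i, j) ∈ contactPairs G ε (γ t)) :
    0 < ⟪(reflectVel (G.sepVec (γ t i).1 (γ t j).1) ((γ t i).2, (γ t j).2)).2 -
          (reflectVel (G.sepVec (γ t i).1 (γ t j).1) ((γ t i).2, (γ t j).2)).1,
        ε⁻¹ • G.sepVec (γ t i).1 (γ t j).1⟫_ℝ := by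
  have hneg := h.inner_sepVec_preVel_neg hp
  simp only [HardSphereCollisionRecord.ofConfig_preVel] at hneg
  rw [real_inner_smul_right, ← neg_sub, inner_neg_left, real_inner_comm]
  have hinv : 0 < ε⁻¹ := inv_pos.2 hε
  nlinarith

end Convention

/-! ## §8 `-- Targets` (rev 3, record): the stubs of the line picked for stmt-13914 (skeleton v2 `Lines/stein-lindeberg-kick-swap.lean`, sha d797db74; that line ended `promote-stub` and is NOT the rev-4 line — see §10–§11)

`payload.targets = payload.stuck_stubs = []` at this seat's arming (lead_cycles = 0), so the six registered stubs were
attacked pre-emptively with the cheap arsenal; NONE broke (F9; drefute v1 @d4e4ab07 and v2 @d797db74 reached the same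
verdict independently, with 12 proved helper lemmas in its `SkeletonPlusHelpers.lean`). The skeleton's vocabulary lives
in a crux workfile that is not a built module (checked: `import …Lines.«stein-lindeberg-kick-swap»` has no `.olean`), so
the verdicts are recorded as prose, object by object; nothing here is a `_false` theorem.

* W1 `stub_kickMatchedMeasurable` (`KickMatchedMeasurable`, S–M): TRUE-shaped. `Driven.measurable_flow` reduces it to
  `Driven.MeasurableRule (kmRule σ N)`; `kmNormal` is a `Nat.find` over the measurable predicates
  `‖d n‖ ≤ 1 ∧ IsAdmissible … (Lambert.lift a (d n)) y` (`Lambert.e₁/e₂` is a measurable, piecewise-continuous frame;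
  `measurableSet_hardSphereDomain`), `kickAt` is `collidePair ∘ Function.update` over `Torus.isMeasurable_geometry`.
  `σ < 1/2` keeps `hsDiameter σ N ≤ σ < 1/2` for every `N`. No junk branch: the statement is pure measurability.
* W2 `stub_kickMatchedStationaryCore` (`KickMatchedStationaryCore`, M–L): TRUE-shaped (5th independent re-derivation
  of the heat-bath identity). On `Σ⁻_{ij}` parametrised by `(x_i, ω, x_rest, velocities)`, `x_j = x_i − εω`, the
  pre-collisional flux measure is `((v_j − v_i)·ω)₊ 1_D ε² dω dx_i dx_rest ⊗ Maxwellians`; the conditional law of `ω`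
  given the rest is the ADMISSIBLE flux law, which is exactly what the rejection sampler draws (candidates
  `Lambert.lift a (d n)`, `a = (v_j − v_i)/‖·‖`, `d n` i.i.d. uniform on the closed unit disc: inverse orthographic
  projection pushes the disc law to the cosine law about `a`, proportional to `hardSphereKernel (v_j, v_i)`; first
  admissible candidate = proposal conditioned on the admissible set), so resampling `ω` and re-placing `x_j` is a
  Gibbs-sampler move on `μ⁻`; the specular step maps `μ⁻` to `μ⁺`; `Qμ⁻ = μ⁺` is invariance. Degenerate cases: `N = 0`
  (free flight, `freeExitTime = sInf ∅ = ∞`), `v_i = v_j` (no incoming contact ever), sampler failure (junk = the true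
  collision, also `μ⁻ → μ⁺`), Zeno (null). The label asymmetry (re-place `j`, keep `x_i`) is a valid choice of
  conditional, not an error. Packing: `(N+1)(π/6)ε³ = (π/6)σ³ < 0.07` for `σ < 1/2`, dilute for every `N`.
* S1 `stub_fairGasContactChaos` (XL, open): not cheaply attackable — exact under the invariant law (W2 + Palm), and
  out of equilibrium it is local equilibrium at resolution `r` for a Gibbs-stationary contact-noise Markov gas; no
  non-LE mechanism for `Z*` is known. NOTE F10(d): its profiles are merely continuous and τ is arbitrary, so a proof
  via relative entropy around a smooth Euler solution (Yau/OVY) is unavailable in general; and BN1 (ideator 3 g2):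
  entropy/L² transfer cannot exclude mesoscopic oscillations at the `r`-scale — S1 owes that conjunct like every line.
* S2 `stub_oneKickInfluence` (M–L as filed; this seat: L): survives (i) the in-shock amplification attack (F9:
  conservation + Lax/Majda count ⇒ zero outgoing monopoles ⇒ influence stays `O(ℓ_s/(N r η))`), (ii) fast pairs
  (influence `∝` pair energy `E`, Campbell tail `e^{−E/θ}`: handled by the choice of `C`), (iii) dense transient
  clusters (dipolar), (iv) spontaneous stochasticity for rough data (F10: the influence compares EXPECTATIONS over
  `Z*`'s future dice, insensitive to one kick if the macroscopic law is universal). Its genuine content is an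
  N-uniform weak-norm STABILITY of the noisy N-body semigroup on two-sphere perturbations in LE (Kac-gap class), for
  which `SpectralContractionR` is neither necessary nor sufficient (decorative, as F5/drefute); nearly vacuous at the
  consumed `r < r₀(η)` (large-deviation regime), loaded only on the `φ_η`-ramp.
* S3a `stub_swapIdentity` (`SwapIdentity`, L): EXACTLY TRUE on good orbits, pathwise before integration:
  `φ_η(D_true(z)) − E_u φ_η(D_*(z,u)) = swapSum_η(z)`, by `stein_lindeberg_identity` with `A_{k−1} = B_k` from the
  `Driven` restart (`stateAfter_succ'`; the restart at the incoming contact `preAt z k` is immediate since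
  `freeExitTime = 0` there), the same ordered pair `i < j` on both sides, the sampler law = `fluxLaw|_A/μ(A)` with
  `μ(A) > 0` at every realised (binary) collision, end cases `numColl = 0` and "after the last collision in `(0,τ]` the
  `Z*` continuation shares the free flight past τ" exact because `defect` reads the path on `[0, τ]` only; hence
  `|swapSum| ≤ 1` wherever the identity holds. Measurability conjuncts: true for ANY `HardSphereFlow` inhabitant
  (a.e. orbit = Alexander orbit; `starDefect` is `Φ`-free). What the prover must supply is bookkeeping: Fubini for
  `kmDice ≅ Die-law ⊗ kmDice` under the shift (`Measure.infinitePi`), joint measurability of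
  `(ω, u) ↦ φ_η(defect(contPath …))`, and the `IsHardSphereTrajectory` API (`binary`, `eq_collidePair_leftLim`,
  `contactPairs_eq_pair`, local finiteness). No limit, no dynamics estimate — agreed "size L, provable after W".
* S3b `stub_swapSumDomination` (XL, open, the lead's): sandwiched exactly as drefute records — cheaply TRUE iff
  `KickMacro` fails (take `C = 1/c₀`), and for `r < r₀` TRUE with `m₀ = 0` given ContactChaos(true) ∧ S1; at fixed
  macroscopic `r` it asserts that the true gas and `Z*` give the smoothed statistic `φ_η(D)` the same expectation
  asymptotically — fine for Lipschitz profiles before shocks (same EOS and mean collisional transfer by the zero-mean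
  teleport flux), conjectural-universality-shaped for rough data (F10 d). Its intended proof (b)–(d) (dictionary
  expansion with `|a_{k,m}| ≤ C` off S2's exceptional collisions) is consistent with F9: no in-shock population
  escapes the `Cε/(N+1)` bound. Not cheaply refutable: `¬S3b` needs an N-independent kick–ambient covariance of the
  TRUE gas, i.e. a contact-scale LE failure — none known (F4).

## §9 Generality audit of the target (F10) — prose record

Quantifier prefix shared by `ContactChaos`, `KickIsotropyInfo`/`KickFairRelEquilibrium`, `FairGasContactChaos`, `OneKickInfluence`,
`SwapIdentity`, `SwapSumDomination`: `∀ (a₀ θ₀ : T3 → ℝ) (u₀ : T3 → V3), Continuous … → 0 < a₀ → 0 < θ₀ → ∃ σ₀ ∀ σ < σ₀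
∀ Φ ∀ τ > 0 …`. The summit conjunct (`Literature…KineticTheory.HydrodynamicLimit`) and the dock `KineticClosure` add
`∀ T ρ u θ, IsHardSphereEulerSolution σ T ρ u θ → … → ∀ t ∈ Ico 0 T`: they are VACUOUS for data without a classical
solution and silent after `T`. So the route's statements carry two surplus regimes — (i) `τ` beyond the first shock,
(ii) rough continuous data — in which (F10 b) the macroscopic state at fixed `τ` is plausibly RANDOM in the limit
(spontaneous stochasticity). The target survives both (F10 c: self-referential reference, `D_∞(r) = O(S₂(r)) → 0`),
but: no deterministic-limit or smooth-relative-entropy proof style is available for the target as typed (F10 d), and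
a planner who ever needs to retreat can cut exactly these regimes without touching `closes` (F10 e). Numbers behind
F10(b), for the record: growth rate `γ(k) ≍ U k^{1−α}`; viscous cutoff from `γ(k) > ν k²`, `ν ≍ ℓ v̄`, `ℓ ≍ N^{−1/3}`:
`k < N^{1/(3(1+α))}` (α = 1/2: `k < N^{2/9}`, `λ > N^{−2/9} ≫ ℓ`); seed `(Nλ³)^{−1/2} = N^{−1/6}` at `λ = N^{−2/9}`;
time to order one `≍ log(N^{1/6})/N^{1/9} → 0`. For Lipschitz `u₀`: `γ ≤ ½‖u₀′‖_∞` (Høiland's bound for plane shear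
flows), seed `≥ N^{−1/2}`, time to order one `≥ ln N/‖∇u₀‖_∞ → ∞` — deterministic limit at every fixed `τ`. -/

/-! ## §10 `-- Line Sketch` (rev 4): typed-object audit of skeleton v1 (PROVED; F14)

The line's objects are the LANDED `Literature.MathematicalPhysics.KineticTheory.VelocityBlindPlacement` (byte-identical
with §0–§2 of `Lines/Sketch.lean`), so — unlike §8 — the audit is stated and kernel-checked on the stubs' own vocabulary.
LANDED verbatim under `Theorems/PercolationClosesChaos/Negative/`: `SketchLineTypedAudit.lean` (p99787 @8ef31b9f8a49) and
`WindowTransferTailGap.lean` (p100304 @6578f61898a9) — importable. -/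

section LineSketch

open Filter Topology
open Literature.Analysis.FluidPDE
open Literature.MathematicalPhysics.KineticTheory hiding bump
open Literature.MathematicalPhysics.KineticTheory.VelocityBlindPlacement

/-- **Normalisation of the close statistic** (F14 a): `(N+1) · ℓ_N³ = (π³ σ⁶)⁻¹` — the number of particles in a
mean-free-path cube is `N`-independent at fixed reduced density (`ℓ_N = (π (N+1) ε_N²)⁻¹`, `ε_N = σ (N+1)^{-1/3}`), so
`closeStat`'s `((N+1) ℓ³)^k` is the right normalisation and an `ℓ`-ball holds `≈ 0.135 ρ σ⁻⁶` particles. [folklore] -/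
theorem card_mul_meanFreePath_cube (σ : ℝ) (N : ℕ) :
    ((N : ℝ) + 1) * meanFreePath σ N ^ 3 = (Real.pi ^ 3 * σ ^ 6)⁻¹ := by
  set M : ℝ := ((N + 1 : ℕ) : ℝ) with hM
  have hMpos : 0 < M := by rw [hM]; positivity
  have hM' : ((N : ℝ) + 1) = M := by rw [hM]; push_cast; ring
  set c : ℝ := M ^ (-(1 / 3 : ℝ)) with hc
  have hc3 : c ^ 3 = M⁻¹ := by
    rw [hc, ← Real.rpow_natCast, ← Real.rpow_mul hMpos.le]
    norm_num
    exact Real.rpow_neg_one M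
  have hdiam : hsDiameter σ N = σ * c := by rw [hsDiameter, hc, hM]
  have hcube : (Real.pi * M * (σ * c) ^ 2) ^ 3 = Real.pi ^ 3 * σ ^ 6 * M := by
    have : (Real.pi * M * (σ * c) ^ 2) ^ 3 = Real.pi ^ 3 * σ ^ 6 * (M ^ 3 * (c ^ 3) ^ 2) := by ring
    rw [this, hc3]
    field_simp
  unfold meanFreePath
  rw [hM', hdiam, inv_pow, hcube]
  field_simp

variable {k N : ℕ}

/-- A constant label test factors out of the close statistic. [folklore] -/
theorem closeStat_const (g : (Fin k → V3) → ℝ) (c σ r : ℝ) (z : Phase N) (x₀ : T3) :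
    closeStat k g (fun _ => c) σ r N z x₀ = c * closeStat k g (fun _ => 1) σ r N z x₀ := by
  simp only [closeStat, mul_one, ← Finset.sum_mul]
  ring

/-- A constant label test factors out of the product statistic. [folklore] -/
theorem allStat_const (c r : ℝ) (z : Phase N) (x₀ : T3) :
    allStat k (fun _ => c) r N z x₀ = c * allStat k (fun _ => 1) r N z x₀ := by
  simp only [allStat, mul_one, ← Finset.sum_mul]
  ring

/-- **VBP is void on the placement marginal** (F14 b, F15 d1): for a CONSTANT label test the cross-ratio defect
`vbpDefect` vanishes identically — for every configuration, every geometry test `g`, every flow, every localiser and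
every `k`. The typed hypothesis of `stub_subMeanFreeTimeWindow` therefore never constrains the empirical placement
geometry `Close_{g,1}`, which W4 of the card evaluates against the hard-core-uniform reference. [folklore] -/
theorem vbpDefect_const (g : (Fin k → V3) → ℝ) (c σ τ r : ℝ) (Φ : Flow σ N) (χ : ℝ × T3 → ℝ) (z : Phase N) :
    vbpDefect k g (fun _ => c) σ τ r N Φ χ z = 0 := by
  have h : ∀ (w : Phase N) (x₀ : T3),
      closeStat k g (fun _ => c) σ r N w x₀ * allStat k (fun _ => 1) r N w x₀ -
        closeStat k g (fun _ => 1) σ r N w x₀ * allStat k (fun _ => c) r N w x₀ = 0 := by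
    intro w x₀
    rw [closeStat_const g c, allStat_const c]
    ring
  unfold vbpDefect
  simp_rw [h]
  simp

/-- The target's bump is non-negative for `r > 0` (for `r < 0` it is not: `3/(π r³) < 0`). [folklore] -/
theorem bump_nonneg {r : ℝ} (hr : 0 < r) (x y : T3) : 0 ≤ bump r x y := by
  unfold bump
  have : 0 ≤ 3 / (Real.pi * r ^ 3) := by positivity
  exact mul_nonneg this (le_max_right _ _)

/-- Weighted Cauchy–Schwarz for vectors: `‖Σ bᵢ vᵢ‖² ≤ (Σ bᵢ)(Σ bᵢ ‖vᵢ‖²)` for weights `b ≥ 0`. [folklore] -/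
theorem norm_sum_smul_sq_le {ι : Type*} (s : Finset ι) (b : ι → ℝ) (hb : ∀ i ∈ s, 0 ≤ b i) (v : ι → V3) :
    ‖∑ i ∈ s, b i • v i‖ ^ 2 ≤ (∑ i ∈ s, b i) * ∑ i ∈ s, b i * ‖v i‖ ^ 2 := by
  have h1 : ‖∑ i ∈ s, b i • v i‖ ≤ ∑ i ∈ s, Real.sqrt (b i) * (Real.sqrt (b i) * ‖v i‖) := by
    refine (norm_sum_le _ _).trans (le_of_eq (Finset.sum_congr rfl fun i hi => ?_))
    rw [norm_smul, Real.norm_eq_abs, abs_of_nonneg (hb i hi), ← mul_assoc, Real.mul_self_sqrt (hb i hi)]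
  have h2 := Finset.sum_mul_sq_le_sq_mul_sq s (fun i => Real.sqrt (b i)) (fun i => Real.sqrt (b i) * ‖v i‖)
  have h3 : ∑ i ∈ s, Real.sqrt (b i) ^ 2 = ∑ i ∈ s, b i :=
    Finset.sum_congr rfl fun i hi => Real.sq_sqrt (hb i hi)
  have h4 : ∑ i ∈ s, (Real.sqrt (b i) * ‖v i‖) ^ 2 = ∑ i ∈ s, b i * ‖v i‖ ^ 2 :=
    Finset.sum_congr rfl fun i hi => by rw [mul_pow, Real.sq_sqrt (hb i hi)]
  rw [h3, h4] at h2
  have h0 : 0 ≤ ‖∑ i ∈ s, b i • v i‖ := norm_nonneg _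
  calc ‖∑ i ∈ s, b i • v i‖ ^ 2 ≤ (∑ i ∈ s, Real.sqrt (b i) * (Real.sqrt (b i) * ‖v i‖)) ^ 2 :=
        pow_le_pow_left₀ h0 h1 2
    _ ≤ _ := h2

/-- **No junk-negative temperature** (F14 c): the `r`-pool temperature fed to the Maxwellian of `maxwellDefect` is
`≥ 0` for every configuration (`= 0` exactly for an empty or a cold pool). [folklore] -/
theorem poolTemperature_nonneg {r : ℝ} (hr : 0 < r) (z : Phase N) (x₀ : T3) : 0 ≤ poolTemperature r N z x₀ := by
  unfold poolTemperature poolVelocity poolEnergy poolMass poolMomentum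
  set c : ℝ := (((N : ℝ) + 1))⁻¹ with hc
  have hcpos : 0 < c := by rw [hc]; positivity
  set B : ℝ := ∑ i : Fin (N + 1), bump r (z i).1 x₀ with hB
  set E : ℝ := ∑ i : Fin (N + 1), bump r (z i).1 x₀ * (‖(z i).2‖ ^ 2 / 2) with hE
  set P : V3 := ∑ i : Fin (N + 1), bump r (z i).1 x₀ • (z i).2 with hP
  have hb : ∀ i ∈ (Finset.univ : Finset (Fin (N + 1))), 0 ≤ bump r (z i).1 x₀ := fun i _ => bump_nonneg hr _ _
  have hBnn : 0 ≤ B := Finset.sum_nonneg hb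
  have hCS : ‖P‖ ^ 2 ≤ B * (2 * E) := by
    have := norm_sum_smul_sq_le Finset.univ (fun i => bump r (z i).1 x₀) hb (fun i => (z i).2)
    have hE2 : 2 * E = ∑ i : Fin (N + 1), bump r (z i).1 x₀ * ‖(z i).2‖ ^ 2 := by
      rw [hE, Finset.mul_sum]; refine Finset.sum_congr rfl fun i _ => ?_; ring
    rw [hE2]; exact this
  rcases hBnn.eq_or_lt with hB0 | hBpos
  · -- empty pool: every weight vanishes, all three moments are 0 and θ is the junk value 0
    have hall : ∀ i ∈ (Finset.univ : Finset (Fin (N + 1))), bump r (z i).1 x₀ = 0 :=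
      (Finset.sum_eq_zero_iff_of_nonneg hb).1 hB0.symm
    have hE0 : E = 0 := Finset.sum_eq_zero fun i hi => by rw [hall i hi, zero_mul]
    have hP0 : P = 0 := Finset.sum_eq_zero fun i hi => by rw [hall i hi, zero_smul]
    rw [hE0, hP0]
    simp
  · have hdiv : c * E / (c * B) = E / B := mul_div_mul_left E B hcpos.ne'
    have hvel : ‖(c * B)⁻¹ • (c • P)‖ ^ 2 = ‖P‖ ^ 2 / B ^ 2 := by
      rw [smul_smul, norm_smul, Real.norm_eq_abs, mul_pow, sq_abs]
      field_simp
    rw [hdiv, hvel]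
    have key : ‖P‖ ^ 2 / B ^ 2 / 2 ≤ E / B := by
      rw [div_div, div_le_div_iff₀ (by positivity) hBpos]
      nlinarith [hCS, hBpos]
    linarith

/-- **Cold-pool junk value** (F14 c): at `θ = 0` the Maxwellian of `maxwellDefect` is `0` (`(2π·0)^{-3/2} = 0` by
`Real.zero_rpow`, `exp(−‖v−u‖²/0) = 1`), not a Dirac mass at `u`; the defect's integrand is then `poolTest F` itself.
Harmless in the typed order (`r` fixed, `N → ∞`), a trap for `r_N → 0` re-typings. [folklore] -/
theorem localMaxwellian_one_zero (u v : V3) : localMaxwellian 1 0 u v = 0 := by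
  unfold localMaxwellian
  have h3 : (Module.finrank ℝ V3 : ℝ) = 3 := by simp
  rw [h3, mul_zero, Real.zero_rpow (by norm_num)]
  simp

/-- **Bounded tests miss the flux moment** (F14 d, F15 d2) — finite shadow of the tail gap in
`stub_subMeanFreeTimeWindow`: the two-point laws `p_n = (1 − 1/(n+1)) δ₀ + (1/(n+1)) δ_{n+1}` converge to their `δ₀`
values on EVERY bounded test `F` (continuity not even needed), yet their flux moment `Σₐ Σ_b pₐ p_b |xₐ − x_b|` tends to
`2 ≠ 0 = ` the flux moment of `δ₀`. In-probability hypotheses over bounded label tests (VBP, LMP) do not control a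
flux-weighted collision functional (`K_N`, whose references `A_r`, `B^Ψ_r` are flux moments of the pool) without the
tail input of #7a `CollisionMomentBound`. [folklore] -/
theorem boundedTests_miss_fluxMoment :
    ∃ (p : ℕ → Fin 2 → ℝ) (x : ℕ → Fin 2 → ℝ),
      (∀ n a, 0 ≤ p n a) ∧ (∀ n, ∑ a, p n a = 1) ∧
      (∀ F : ℝ → ℝ, (∃ C, ∀ v, |F v| ≤ C) →
        Tendsto (fun n => ∑ a, p n a * F (x n a)) atTop (𝓝 (F 0))) ∧
      Tendsto (fun n => ∑ a, ∑ b, p n a * p n b * |x n a - x n b|) atTop (𝓝 2) := by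
  refine ⟨fun n => ![1 - 1 / ((n : ℝ) + 1), 1 / ((n : ℝ) + 1)], fun n => ![0, (n : ℝ) + 1], ?_, ?_, ?_, ?_⟩
  · intro n a
    have h1 : (0 : ℝ) ≤ 1 / ((n : ℝ) + 1) := by positivity
    have h2 : 1 / ((n : ℝ) + 1) ≤ 1 := by
      rw [div_le_one (by positivity)]; linarith [n.cast_nonneg (α := ℝ)]
    fin_cases a
    · simp only [Fin.zero_eta, Matrix.cons_val_zero]
      linarith
    · simp only [Fin.mk_one, Matrix.cons_val_one]
      exact h1
  · intro n; simp [Fin.sum_univ_two]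
  · intro F ⟨C, hC⟩
    have hlim0 : Tendsto (fun n : ℕ => 1 / ((n : ℝ) + 1)) atTop (𝓝 0) := tendsto_one_div_add_atTop_nhds_zero_nat
    have hA : Tendsto (fun n : ℕ => (1 - 1 / ((n : ℝ) + 1)) * F 0) atTop (𝓝 ((1 - 0) * F 0)) :=
      (tendsto_const_nhds.sub hlim0).mul_const (F 0)
    rw [sub_zero, one_mul] at hA
    have hB : Tendsto (fun n : ℕ => 1 / ((n : ℝ) + 1) * F ((n : ℝ) + 1)) atTop (𝓝 0) := by
      apply squeeze_zero_norm (a := fun n : ℕ => C * (1 / ((n : ℝ) + 1)))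
      · intro n
        rw [Real.norm_eq_abs, abs_mul, abs_of_nonneg (by positivity : (0:ℝ) ≤ 1 / ((n : ℝ) + 1))]
        have := hC ((n : ℝ) + 1)
        have h0 : (0 : ℝ) ≤ 1 / ((n : ℝ) + 1) := by positivity
        nlinarith
      · simpa using hlim0.const_mul C
    have := hA.add hB
    simp only [add_zero] at this
    simpa [Fin.sum_univ_two] using this
  · have hlim0 : Tendsto (fun n : ℕ => 1 / ((n : ℝ) + 1)) atTop (𝓝 0) := tendsto_one_div_add_atTop_nhds_zero_nat
    have key : ∀ n : ℕ, (∑ a, ∑ b, (![1 - 1 / ((n : ℝ) + 1), 1 / ((n : ℝ) + 1)] : Fin 2 → ℝ) a *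
        (![1 - 1 / ((n : ℝ) + 1), 1 / ((n : ℝ) + 1)] : Fin 2 → ℝ) b *
        |(![0, (n : ℝ) + 1] : Fin 2 → ℝ) a - (![0, (n : ℝ) + 1] : Fin 2 → ℝ) b|) = 2 * (1 - 1 / ((n : ℝ) + 1)) := by
      intro n
      have hn : (0 : ℝ) < (n : ℝ) + 1 := by positivity
      simp only [Fin.sum_univ_two, Matrix.cons_val_zero, Matrix.cons_val_one, sub_self, abs_zero,
        mul_zero, zero_sub, abs_neg, sub_zero, zero_add, add_zero, abs_of_pos hn]
      field_simp
      ring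
    simp_rw [key]
    have h2 : Tendsto (fun n : ℕ => 2 * (1 - 1 / ((n : ℝ) + 1))) atTop (𝓝 (2 * (1 - 0))) :=
      (tendsto_const_nhds.sub hlim0).const_mul 2
    rw [sub_zero, mul_one] at h2
    exact h2

end LineSketch

/-! ## §11 `-- Line Sketch` (rev 4): stub verdicts of skeleton v1 `Lines/Sketch.lean` (10:32Z) — prose record (F15)

`payload.line = {slug: Sketch, lead: prover-line-stmt-AtomisticToContinuum-14915-0}`, `payload.stuck_stubs = targets = []`
(lead_cycles = 0), so the three registered stubs were attacked pre-emptively. NOTHING IS FALSE; verdicts and what would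
change them:

* `stub_velocityBlindPlacement : KickFairRelEquilibrium → VBP` (lead; "open content of the line"). VACUOUS-BY-ANTECEDENT
  (F13: KFRE plausibly false as typed at fixed `r`; not landable). Conclusion VBP believed TRUE: (i) under local Gibbs
  positions ⊥ labels exactly (`localGibbsProfile` is a product `a₀(x)·M_{1,u₀(x),θ₀(x)}(v)`; given the labels, placement
  is hard-core-uniform with an `a₀`-tilt that is label-free); (ii) at `t > 0` the only label–geometry coupling at scale
  `ℓ` is the pre-collisional / post-collisional asymmetry of pairs receding along their relative velocity, which CANCELS EXACTLY under
  detailed balance for Maxwellian pools (Liouville + `M⊗M` collision-invariant) and survives at `O(Kn)` through the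
  Chapman–Enskog correction `f = M(1 + Kn φ₁)` (`φ₁⊗φ₁`-terms are not collision-invariant); static contact structure at
  `ε…2ε` is label-blind in LE; (iii) the fixed-`r` floor "mixture of products ≠ product of mixtures" (`O(r²|∇u|²)` for
  `F` quadratic in velocity differences: close pairs see `u`-differences `O(ℓ∇u) → 0`, pool⊗pool pairs `O(r∇u)`) is
  absorbed by `∃ r₀` FIRST. A kill of VBP would need a non-LE velocity–geometry coupling of order 1 on positive
  space-time measure — none known (F4). Typed objects audited (§10, F14 a–b). The card's mechanism line "KFRE is VBP's
  transverse ε-scale component" is not consumed by the skeleton (the stub is a bare implication), so F13 costs the line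
  nothing beyond bookkeeping.
* `stub_localMaxwellian : SpectralContractionR → LMP` (W6 made explicit). `SpectralContractionR` DECORATIVE (D2/F5, fifth
  instance on this crux): LMP is local Maxwellianity of the EMPIRICAL one-particle law of the deterministic flow in
  probability — an H-theorem-class statement at fixed σ; a constant of the tagged-sphere operator in a Maxwellian bath is
  neither necessary nor sufficient. LMP believed TRUE (`Kn → 0`; t = 0 mixture defect `O(r²(∇u)² + r²(∇θ)²)` absorbed by
  `∃ r₀`; shock/Knudsen layers have space-time volume `O(ℓ) → 0` against continuous `χ`; F10's spontaneously stochastic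
  regime keeps `Kn_local → 0`). Junk audit §10 (F14 c): `θ_pool ≥ 0` always, `= 0` ⇒ Maxwellian junk `0`.
* `stub_subMeanFreeTimeWindow : VBP → LMP → ContactChaos` ("the transfer; no spectral input"; implicitly no open content).
  TRUE as a proposition (its conclusion is believed true) but NOT CLOSABLE AS TYPED — F15 (d1) geometry: HUCP is consumed
  by W4 and supplied by nobody (`vbpDefect_const`); (d2) tails: #7a `CollisionMomentBound` is consumed by W1–W3 and
  supplied by nobody (`boundedTests_miss_fluxMoment`); (d3) product → joint tests fine given (d2). Proposed re-typing:
  `VBP → HUCP → LMP → CollisionMomentBound → ContactChaos` with HUCP a fourth registered stub (LE class). A refuter cannot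
  produce `¬stub` here (that is `VBP ∧ LMP ∧ ¬ContactChaos`); the finding is about proof obligations, filed as
  `stub-misstated` so that the line's census of open content is honest (three LE-class snapshot statements + #7a, not two).
* JOINT SUFFICIENCY: `PercolationClosesChaos_of hK hS := stub_subMeanFreeTimeWindow (stub_velocityBlindPlacement hK)
  (stub_localMaxwellian hS)` is kernel-checked composition; no gap there. The line proves the crux BY NAME; if F13's repair
  R2 re-types KFRE, only `stub_velocityBlindPlacement`'s antecedent changes.
* What this seat did NOT do (for the next re-arm): no MD/kit run (the ideator's VBP toy kit j015433 exists: M2 "VBP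
  statistic over time incl. approaching/receding split" — to be re-read against (ii) above if the lead asks; a clean
  falsifier of VBP at the physics level would be an event-driven MD measuring the label law of receding vs approaching
  close pairs in a sheared LE state and checking the `O(Kn)` scaling — `disprover-wanted:` material, not run this cycle). -/

/-! ## §12 `-- Line Sketch` (rev 12, card ergodic-window-is-von-neumann): finite shadow of the docking-reference gap (PROVED)

The target `ContactChaos` reads its `r`-ball pair fields through the TIME MOLLIFIER `bt a = r⁻¹ (1 − |a|/r)₊` centred
at the collision time (`Pm`), i.e. it compares a collision at time `s` with the ball's pair law averaged over
`[s − r, s + r]`; the typed docking conjunct `NoMesoscopicOscillation` of `Lines/Sketch.lean` (14:08Z) compares the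
kinetic cell with the INSTANTANEOUS ball field `Pr … (w·Mhℓ)` at the window start. At a time where the ball's pair law
jumps (a shock crossing the ball: width `≍ ℓ_N ≪ r`, crossing time `≍ r`), the two references differ by half the jump AT
EVERY RESOLUTION `r` — the shadow below: the hat-mollified Heaviside step is `1/2` at the jump, the instantaneous value
is `1`. So `stub_kineticDocking` consumes, silently, time-regularity over `±r` (and, through the `b_r(x₀, x)`-offset in
`Q`, a kernel swap at scale `r`) of the evolved `r`-ball pair fields — free for continuous macroscopic limits, paid only
IN MEASURE (`≍ Area·r`) near shocks, LE-class in general; the honest place for it is the crux-class conjunct itself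
(corrected signature in the module docstring, F18). -/

section DockingGap

open Real intervalIntegral Set

/-- The target's time mollifier `bt` of width `r` (literally `ContactChaos`'s `bt`): `r⁻¹ · (1 − |a|/r)₊`. -/
noncomputable def hat (r a : ℝ) : ℝ := r⁻¹ * max (1 - |a| / r) 0

/-- **Docking-reference gap, finite shadow.** Read through the target's mollifier, a unit step at the reading time is
worth `1/2`, for EVERY width `r > 0` — while the instantaneous reading (the typed `NoMesoscopicOscillation`) is `1`.
[folklore] -/
theorem integral_hat_mul_heaviside {r : ℝ} (hr : 0 < r) :
    ∫ s in Set.Icc (-r) r, hat r s * (if 0 ≤ s then (1 : ℝ) else 0) = 1 / 2 := by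
  have hcongr : Set.EqOn (fun s => hat r s * (if 0 ≤ s then (1 : ℝ) else 0))
      (Set.indicator (Set.Ici 0) (fun s => r⁻¹ * (1 - s / r))) (Set.Icc (-r) r) := by
    intro s hs
    by_cases h0 : 0 ≤ s
    · have h1 : 0 ≤ 1 - s / r := by
        rw [sub_nonneg, div_le_one hr]; exact hs.2
      simp only [hat, h0, if_true, mul_one, abs_of_nonneg h0, max_eq_left h1,
        Set.indicator_of_mem (show s ∈ Set.Ici (0 : ℝ) from h0)]
    · simp only [h0, if_false, mul_zero, Set.indicator_of_notMem (show s ∉ Set.Ici (0 : ℝ) from h0)]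
  rw [setIntegral_congr_fun measurableSet_Icc hcongr, setIntegral_indicator measurableSet_Ici]
  have hset : Set.Icc (-r) r ∩ Set.Ici 0 = Set.Icc 0 r := by
    ext s
    simp only [Set.mem_inter_iff, Set.mem_Icc, Set.mem_Ici]
    constructor
    · rintro ⟨⟨-, h2⟩, h3⟩; exact ⟨h3, h2⟩
    · rintro ⟨h1, h2⟩; exact ⟨⟨by linarith, h2⟩, h1⟩
  rw [hset, integral_Icc_eq_integral_Ioc, ← intervalIntegral.integral_of_le hr.le,
    intervalIntegral.integral_const_mul]
  have hsub : ∫ x : ℝ in (0 : ℝ)..r, (1 - x / r) = r / 2 := by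
    rw [intervalIntegral.integral_sub, intervalIntegral.integral_const, intervalIntegral.integral_div,
      integral_id]
    · simp only [sub_zero, smul_eq_mul, mul_one]
      field_simp
      ring
    · exact intervalIntegrable_const
    · exact (continuous_id.div_const r).intervalIntegrable 0 r
  rw [hsub]
  field_simp

/-- The instantaneous reading of the same step at the same time is `1`; the gap is exactly half the jump, independent
of `r` — it does not close as `r → 0`. [folklore] -/
theorem docking_reference_gap {r : ℝ} (hr : 0 < r) :
    (if (0 : ℝ) ≤ 0 then (1 : ℝ) else 0) - ∫ s in Set.Icc (-r) r, hat r s * (if 0 ≤ s then (1 : ℝ) else 0)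
      = 1 / 2 := by
  rw [integral_hat_mul_heaviside hr]
  norm_num

end DockingGap

/-! ## §13 Necklace states — the probe, the RETRACTED floor, and the bookkeeping lemmas (F20)

What stays: the kernel-checked lemmas below are correct abstract statements — Chebyshev for exponential moments
(`exp_mul_measureReal_le_integral_exp`, used by F21) and the Donsker–Varadhan bookkeeping of a HYPOTHETICAL event family of
extensive cost `P(B ≥ x) ≥ e^{−(N+1)(a x² + b x)}` (`quadraticCost_sup_attained`, `dv_choice_void`, `dv_bound_floor`,
`necklace_term_ge`, `dv_floor_two_branch`: such a family would cap the DV-certifiable bound below by `min(h/(2b), ½√(h/a))`).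
What is RETRACTED (versions 1–2, 14:40–14:55Z): that wrapped necklaces ARE such a family for the window-averaged
collision-weighted bad fraction `B` of `KineticCellChaosLG`. They are not: the transverse dynamics of a chain loaded by a momentum
flux is Euler buckling — a passage kicks ball `j`'s transverse velocity by `−(v/ε)(Ly)_j` and kicks accumulate, so the staggered
mode grows by `e^{√(8g/ε)}` per passage (not `1 + 4g/ε`), the stability exponent over a lifetime `τ'` is
`E_s ≈ 2√2 vτ'√(j/(Gε))`, and holding `B ≥ x` over the horizon costs `≥ c₁√2 π x τ σ^{5/2}(N+1)^{7/6}` in alignment precision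
whatever `v, τ', j, G` (bursts are diluted by `W⁻¹Σ_w` and cost `≍ N^{5/3}`): SUPER-EXTENSIVE, no floor. The DV transfer's hidden
input (F18 d) is therefore NOT refuted by necklaces. The probe pays off elsewhere: §14 / F21. -/

section Necklace

/-- **Chebyshev for exponential moments** (the step turning a cheap tail event into a floor of the log-moment generating
function): for `0 < t`, `exp(t x) · μ{x ≤ B} ≤ ∫ exp(t B) dμ`. [folklore] -/
theorem exp_mul_measureReal_le_integral_exp {Ω : Type*} [MeasurableSpace Ω] (μ : Measure Ω) {B : Ω → ℝ} {t : ℝ}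
    (ht : 0 < t) (hint : Integrable (fun ω => Real.exp (t * B ω)) μ) (x : ℝ) :
    Real.exp (t * x) * μ.real {ω | x ≤ B ω} ≤ ∫ ω, Real.exp (t * B ω) ∂μ := by
  have hset : {ω | Real.exp (t * x) ≤ Real.exp (t * B ω)} = {ω | x ≤ B ω} := by
    ext ω
    simp only [Set.mem_setOf_eq, Real.exp_le_exp]
    exact mul_le_mul_iff_of_pos_left ht
  have h := mul_meas_ge_le_integral_of_nonneg (Filter.Eventually.of_forall fun ω => (Real.exp_pos (t * B ω)).le)
    hint (Real.exp (t * x))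
  rwa [hset] at h

/-- **The quadratic-cost supremum**: `sup_x ((λ − b) x − a x²) ≥ (λ − b)²/(4a)`, attained at `x⋆ = (λ − b)/(2a)`. [folklore] -/
theorem quadraticCost_sup_attained {a b lam : ℝ} (ha : 0 < a) :
    (lam - b) * ((lam - b) / (2 * a)) - a * ((lam - b) / (2 * a)) ^ 2 = (lam - b) ^ 2 / (4 * a) := by
  field_simp
  ring

/-- **DV bookkeeping, hypothetical extensive-cost family** (`P(B ≥ x) ≥ e^{−(N+1)(ax²+bx)}`; NO instance on this crux after the
retraction of F20): with per-particle entropy budget `K`, the choice `λ = 2K/δ` would require `(λ − b)²/(4a) ≤ K`, which fails for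
every `δ² < K/(4a)` (and `b ≤ K/δ`). [folklore] -/
theorem dv_choice_void {a b K δ : ℝ} (ha : 0 < a) (hK : 0 < K) (hδ : 0 < δ) (hb : b ≤ K / δ)
    (hsmall : δ ^ 2 < K / (4 * a)) : K < (2 * K / δ - b) ^ 2 / (4 * a) := by
  have h1 : K / δ ≤ 2 * K / δ - b := by
    have : 2 * K / δ = K / δ + K / δ := by ring
    linarith
  have hKδ : 0 < K / δ := div_pos hK hδ
  have h2 : (K / δ) ^ 2 ≤ (2 * K / δ - b) ^ 2 := by
    exact pow_le_pow_left₀ hKδ.le h1 2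
  have h3 : K < (K / δ) ^ 2 / (4 * a) := by
    rw [lt_div_iff₀ (by positivity), div_pow]
    rw [lt_div_iff₀ (by positivity)] at hsmall
    have hδ2 : 0 < δ ^ 2 := by positivity
    rw [lt_div_iff₀ hδ2]
    nlinarith
  calc K < (K / δ) ^ 2 / (4 * a) := h3
    _ ≤ (2 * K / δ - b) ^ 2 / (4 * a) := by gcongr

/-- AM–GM half of the (hypothetical) two-branch floor; also the shape of F21's cost optimisation `A/v² + v²/2 ≥ √(2A)`:
`K/λ + λ/(16a) ≥ 2√(K/(16a))`. [folklore] -/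
theorem dv_bound_floor {a K lam : ℝ} (ha : 0 < a) (hK : 0 < K) (hlam : 0 < lam) :
    2 * Real.sqrt (K / (16 * a)) ≤ K / lam + lam / (16 * a) := by
  have h16 : (0 : ℝ) < 16 * a := by positivity
  set x := K / lam with hxdef
  set y := lam / (16 * a) with hydef
  have hx : 0 ≤ x := (div_pos hK hlam).le
  have hy : 0 ≤ y := (div_pos hlam h16).le
  have hprod : K / (16 * a) = x * y := by
    rw [hxdef, hydef]; field_simp
  rw [hprod, Real.sqrt_mul hx]
  nlinarith [sq_nonneg (Real.sqrt x - Real.sqrt y), Real.sq_sqrt hx, Real.sq_sqrt hy,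
    Real.sqrt_nonneg x, Real.sqrt_nonneg y]

/-- The regime remark made precise: for `2b ≤ λ`, `(λ − b)²/(4aλ) ≥ λ/(16a)`. [folklore] -/
theorem necklace_term_ge {a b lam : ℝ} (ha : 0 < a) (hlam : 2 * b ≤ lam) (hlam0 : 0 < lam) :
    lam / (16 * a) ≤ (lam - b) ^ 2 / (4 * a * lam) := by
  rw [div_le_div_iff₀ (by positivity) (by positivity)]
  nlinarith [sq_nonneg (lam - 2 * b), mul_pos ha hlam0]

/-- **Two-branch floor for a hypothetical extensive-cost family** (no instance on this crux after the retraction of F20): for every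
rate `λ > 0`, `h/λ + (λ − b)₊²/(4aλ) ≥ min (h/(2b)) (2√(h/(16a)))` — small rates pay the entropy, large rates pay the family.
[folklore] -/
theorem dv_floor_two_branch {a b h lam : ℝ} (ha : 0 < a) (hb : 0 < b) (hh : 0 < h) (hlam : 0 < lam) :
    min (h / (2 * b)) (2 * Real.sqrt (h / (16 * a))) ≤ h / lam + (max (lam - b) 0) ^ 2 / (4 * a * lam) := by
  rcases le_or_gt lam (2 * b) with hle | hlt
  · refine min_le_of_left_le ?_
    have h1 : h / (2 * b) ≤ h / lam := by
      apply div_le_div_of_nonneg_left hh.le hlam hle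
    have h2 : 0 ≤ (max (lam - b) 0) ^ 2 / (4 * a * lam) := by positivity
    linarith
  · refine min_le_of_right_le ?_
    have hmax : max (lam - b) 0 = lam - b := max_eq_left (by linarith)
    rw [hmax]
    have h1 := necklace_term_ge (b := b) ha hlt.le hlam
    have h2 := dv_bound_floor ha hh hlam
    linarith

end Necklace

/-! ## §14 A fast single-pulse necklace burst: no speed-N upper deviation bound for `K_N[|v_i|² + |v_j|²]` under the invariant law (F21, prose)

Kernel-checked ingredients: §13's `exp_mul_measureReal_le_integral_exp` (Chebyshev) and the AM–GM shape of `dv_bound_floor`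
(`A/v² + v²/2 ≥ √(2A)`, here `A = c₁K₀(N+1)^{4/3}/σ` the buckling bill per unit `v⁻²`). The event: the F20 necklace with ONE pulse of
speed `v = (2c₁K₀/σ)^{1/4}(N+1)^{1/3}` kept alive for `τ' = K₀ε(N+1)/(4v³) ≍ N^{-1/3}`; it makes `n = 2vτ'/ε²` head-on collisions each
carrying `|v_i|² + |v_j|² = v²`, so `K_N[|v_i|²+|v_j|²] ≥ 2εnv²/(N+1) = 4v³τ'/(ε(N+1)) = K₀`, at total `G_N`-cost
`√(2c₁K₀/σ)(N+1)^{2/3}(1+o(1))`, `c₁ ∈ [4/π, 4]` — SUB-EXTENSIVE (buckling exponent `E_s = 2√2vτ'/ε ≍ N^{1/3}` for `k ≍ N^{1/3}`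
balls; kinetic `v²/2`; protection `7σN^{2/3}τ' ≍ N^{1/3}`; bookkeeping `N^{1/3}log N`). Consequence:
`P_{G_N}(K_N[|v_i|²+|v_j|²] ≥ K₀) ≥ e^{−√(2c₁K₀/σ)(N+1)^{2/3}(1+o(1))}` for every `K₀`, so no `O(N)` entropy budget and no `Λ^{N+1}`
density domination can transfer tightness of the energy-moment collision functional from `G_N` to local Gibbs data: the
recorded plan of `CollisionMomentBound` (stmt-15144) is void for that part (the count part `K_N[1]` keeps a super-extensive
buckling bill `≍ N^{4/3}`). The STATEMENT of 15144 is not touched (necklaces are `e^{−N^{2/3}}`-rare under `LG` too); its provers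
need the tail from the evolved law directly. -/

end Summit.AtomisticToContinuum.HydrodynamicLimit.Cruxes.PercolationClosesChaos.Disproof
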